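import Literature.NumberTheory.LFunctions.RodgersTaoAsymptoticsProofs
import Literature.Analysis.Complex.BorelCaratheodoryDeriv
import Mathlib.Analysis.SpecialFunctions.Complex.LogBounds
import Mathlib.Analysis.Calculus.MeanValue
import HarnessLib

/-!
# Rodgers–Tao, Lemma 2.1 (iii): the logarithmic-derivative asymptotic (9) for `H_t`, `−T₀ ≤ t ≤ 0`

B. Rodgers and T. Tao, *The de Bruijn–Newman constant is non-negative*, Forum Math. Pi **8**
(2020) e6 [RodgersTaoFMP2020], §2: FMP Lemma 4 (= arXiv Lemma 2.1) eq. (9), proof on FMP p. 19.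

«bears_on: N-C/N-P (COLUMN 3 DBN) — RH-FREE DISCHARGE (reduction), 0 new facts.»
WHAT THIS IS NOT: an unconditional asymptotic for `H_t'/H_t` in the region
`x ≥ C''`, `C' ≤ κ ≤ C`; it is the input to the Riemann–von Mangoldt count (Rodgers–Tao §3) and says
nothing about the truth of RH.

## Main result

* `rodgersTao_logDeriv_H_asymp_of : rodgersTao_H_eq_half_Q_one → rodgersTao_I_asymp →
  rodgersTao_logDeriv_H_asymp` — eq. (9) for `−T₀ ≤ t ≤ 0` from the p. 19 estimate
  `H_t = ½ Q_{t,1}(1 + O(log₊² x/x))` and the stationary-phase asymptotic (31);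
* `rodgersTao_logDeriv_H_asymp_of_H_eq_half_Q_one : rodgersTao_H_eq_half_Q_one →
  rodgersTao_logDeriv_H_asymp` — the same with (31) discharged by `rodgersTao_I_asymp_holds`.

## Proof architecture (FMP p. 19, with the `n = 1` main terms made explicit)

The printed argument sends `t → 0` in (36) and applies Borel–Carathéodory to `H_t/H_0`. We follow
the same two ingredients — a multiplicative approximation of `H_t` by the exponential of an explicit
holomorphic phase on discs of radius `≍ log₊ x`, then "the Borel–Carathéodory theorem and the Cauchy
integral formula" — but avoid the limit: by Lemma 2.3 (strip saddle points `w₀` of (23)) and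
first-order stationarity of the `t = 0` phase at `w₁ = ¼ Log(ζ/4π)` (`saddle_perturbation`:
`w₀ = w₁ + O(|t| log₊ x/x)`, phase`(t, w₀) =` phase`(0, w₁) + t w₁² + O(log₊² x/x)`), (31) gives
`I_t(π, ζ) = c₀ e^{g_t(ζ)}(1 + O(log₊² x/x))` with the explicit holomorphic
`g_t(ζ) = −ζ/4 + (ζ − 2) w₁(ζ) + t w₁(ζ)²`; the second term of `Q_{t,1}` is `O(1/x)` of the first
(`norm_cexp_phase_sub_le`), so `H_t(w) = π² c₀ e^{g_t(9 + iw)}(1 + O(log₊² x/x))` on the disc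
`|w − z| < log₊ x/2` (`pointwise_estimate`, `disc_point`); Borel–Carathéodory
(`Literature.Analysis.Complex.norm_logDeriv_le_of_log_norm_le`) applied to `H_t e^{−g}` yields
`H_t'/H_t(z) = g'(z) + O(log₊ x/x)` (`logDeriv_near_of_near_exp`), and
`g'(z) = (i/4) Log(iz/4π) + O(log₊ x/x)` (`phase_deriv_near`). The endpoint `t = 0` is
`rodgersTao_logDeriv_H0_asymp_holds`. (Why (31) rather than the typed (36): (36) carries a relative
error `A/√x`, which does not compose through Borel–Carathéodory on discs of radius `≍ log₊ x` to the
`A log₊ x/x` of (9); see rt/ERRATA E11.)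

## References

* [RodgersTaoFMP2020] B. Rodgers, T. Tao, Forum Math. Pi 8 (2020) e6, doi:10.1017/fmp.2020.6
  (= arXiv:1801.05914), Lemma 2.1 (iii) eq. (9), Lemma 2.3, eqs. (21)–(23), (31), p. 19.
-/

noncomputable section

open Complex Set Filter Topology
open scoped Real

namespace Literature.NumberTheory.LFunctions

namespace RodgersTaoLogDeriv

/-! ## §1 Elementary helpers -/

/-- `‖Log v‖ ≤ |log ‖v‖| + π`. [folklore] -/
private theorem norm_log_le (v : ℂ) : ‖Complex.log v‖ ≤ |Real.log ‖v‖| + π := by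
  refine (norm_le_abs_re_add_abs_im _).trans ?_
  rw [Complex.log_re, Complex.log_im]
  exact add_le_add le_rfl (Complex.abs_arg_le_pi v)

/-- Lipschitz bound for `Log` along a horizontal line in the open right half-plane:
`‖Log u₁ − Log u₂‖ ≤ ‖u₁ − u₂‖ / v` if `Im u₁ = Im u₂ = v > 0` and `Re uᵢ > 0`. [folklore] -/
private theorem norm_log_sub_log_le {u₁ u₂ : ℂ} {v : ℝ} (hv : 0 < v) (h1 : u₁.im = v)
    (h2 : u₂.im = v) (hr1 : 0 < u₁.re) (hr2 : 0 < u₂.re) :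
    ‖Complex.log u₁ - Complex.log u₂‖ ≤ 1 / v * ‖u₁ - u₂‖ := by
  set S : Set ℂ := {u : ℂ | 0 < u.re ∧ u.im = v} with hS
  have hconv : Convex ℝ S := by
    have e : S = {u : ℂ | 0 < u.re} ∩ ({u : ℂ | v ≤ u.im} ∩ {u : ℂ | u.im ≤ v}) := by
      ext u; simp only [hS, mem_setOf_eq, mem_inter_iff]; constructor
      · rintro ⟨h, h'⟩; exact ⟨h, h'.ge, h'.le⟩
      · rintro ⟨h, h', h''⟩; exact ⟨h, le_antisymm h'' h'⟩
    rw [e]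
    exact (convex_halfSpace_re_gt 0).inter
      ((convex_halfSpace_im_ge v).inter (convex_halfSpace_im_le v))
  have hslit : ∀ u ∈ S, u ∈ Complex.slitPlane := fun u hu ↦
    Complex.mem_slitPlane_iff.2 (Or.inl hu.1)
  have hdiff : ∀ u ∈ S, DifferentiableAt ℂ Complex.log u := fun u hu ↦
    (Complex.hasDerivAt_log (hslit u hu)).differentiableAt
  have hbound : ∀ u ∈ S, ‖deriv Complex.log u‖ ≤ 1 / v := by
    intro u hu
    rw [(Complex.hasDerivAt_log (hslit u hu)).deriv, norm_inv]
    have hvu : v ≤ ‖u‖ := by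
      have := abs_im_le_norm u
      rw [hu.2, abs_of_pos hv] at this
      exact this
    rw [one_div]
    exact inv_anti₀ hv hvu
  have hmem1 : u₁ ∈ S := ⟨hr1, h1⟩
  have hmem2 : u₂ ∈ S := ⟨hr2, h2⟩
  exact hconv.norm_image_sub_le_of_norm_deriv_le hdiff hbound hmem2 hmem1

/-- `log₊ x ≤ 2 √(2 + |x|)`. [folklore] -/
private theorem logPlus_le_two_mul_sqrt (x : ℝ) : logPlus x ≤ 2 * Real.sqrt (2 + |x|) := by
  rw [logPlus_eq]
  have h0 : (0 : ℝ) ≤ 2 + |x| := by positivity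
  have h := Real.log_le_rpow_div h0 (by norm_num : (0 : ℝ) < 1 / 2)
  rw [Real.sqrt_eq_rpow]
  calc Real.log (2 + |x|) ≤ (2 + |x|) ^ (1 / 2 : ℝ) / (1 / 2) := h
    _ = 2 * (2 + |x|) ^ (1 / 2 : ℝ) := by ring

/-- `log₊ x ≤ 4 (2 + |x|)^{1/4}`, hence `log₊² x ≤ 16 √(2 + |x|)`. [folklore] -/
private theorem logPlus_sq_le (x : ℝ) : logPlus x ^ 2 ≤ 16 * Real.sqrt (2 + |x|) := by
  rw [logPlus_eq]
  have h0 : (0 : ℝ) ≤ 2 + |x| := by positivity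
  have h := Real.log_le_rpow_div h0 (by norm_num : (0 : ℝ) < 1 / 4)
  have h1 : Real.log (2 + |x|) ≤ 4 * (2 + |x|) ^ (1 / 4 : ℝ) := by
    calc Real.log (2 + |x|) ≤ (2 + |x|) ^ (1 / 4 : ℝ) / (1 / 4) := h
      _ = 4 * (2 + |x|) ^ (1 / 4 : ℝ) := by ring
  have hlog0 : 0 ≤ Real.log (2 + |x|) := Real.log_nonneg (by linarith [abs_nonneg x])
  have h2 : Real.log (2 + |x|) ^ 2 ≤ (4 * (2 + |x|) ^ (1 / 4 : ℝ)) ^ 2 :=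
    pow_le_pow_left₀ hlog0 h1 2
  have h3 : ((2 + |x|) ^ (1 / 4 : ℝ)) ^ 2 = Real.sqrt (2 + |x|) := by
    rw [← Real.rpow_natCast, ← Real.rpow_mul h0, Real.sqrt_eq_rpow]
    norm_num
  calc Real.log (2 + |x|) ^ 2 ≤ (4 * (2 + |x|) ^ (1 / 4 : ℝ)) ^ 2 := h2
    _ = 16 * ((2 + |x|) ^ (1 / 4 : ℝ)) ^ 2 := by ring
    _ = 16 * Real.sqrt (2 + |x|) := by rw [h3]

/-- For `x ≥ 1`: `log₊² x / x ≤ 28 / √x`. [folklore] -/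
private theorem logPlus_sq_div_le {x : ℝ} (hx : 1 ≤ x) : logPlus x ^ 2 / x ≤ 28 / Real.sqrt x := by
  have hx0 : 0 < x := by linarith
  have h1 := logPlus_sq_le x
  rw [abs_of_pos hx0] at h1
  have h2 : Real.sqrt (2 + x) ≤ Real.sqrt 3 * Real.sqrt x := by
    rw [← Real.sqrt_mul (by norm_num)]
    exact Real.sqrt_le_sqrt (by linarith)
  have h3 : Real.sqrt 3 ≤ 7 / 4 := by
    rw [Real.sqrt_le_left (by norm_num)]
    norm_num
  have hsx : 0 < Real.sqrt x := Real.sqrt_pos.2 hx0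
  rw [div_le_div_iff₀ hx0 hsx]
  have hxx : Real.sqrt x * Real.sqrt x = x := Real.mul_self_sqrt hx0.le
  nlinarith [hsx, hxx, Real.sqrt_nonneg (2 + x)]

/-- Smallness threshold: for `x ≥ max 1 (28/ε)²`, `log₊² x / x ≤ ε`. [folklore] -/
private theorem logPlus_sq_div_le_of_le {ε x : ℝ} (hε : 0 < ε) (hx1 : 1 ≤ x)
    (hx : (28 / ε) ^ 2 ≤ x) : logPlus x ^ 2 / x ≤ ε := by
  have hx0 : 0 < x := by linarith
  have h1 := logPlus_sq_div_le hx1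
  have hs : 28 / ε ≤ Real.sqrt x := by
    rw [← Real.sqrt_sq (by positivity : (0 : ℝ) ≤ 28 / ε)]
    exact Real.sqrt_le_sqrt hx
  have hsx : 0 < Real.sqrt x := Real.sqrt_pos.2 hx0
  calc logPlus x ^ 2 / x ≤ 28 / Real.sqrt x := h1
    _ ≤ 28 / (28 / ε) := div_le_div_of_nonneg_left (by norm_num) (by positivity) hs
    _ = ε := by field_simp

/-- `log₊ x / x ≤ 2 · log₊² x / x` (as `log₊ x ≥ log 2 ≥ 1/2`). [folklore] -/
private theorem logPlus_div_le {x : ℝ} (hx : 0 < x) : logPlus x / x ≤ 2 * (logPlus x ^ 2 / x) := by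
  have hL : 1 / 2 ≤ logPlus x := by
    have h := log_two_le_logPlus x
    have h2 : (1 / 2 : ℝ) ≤ Real.log 2 := by
      have := Real.log_two_gt_d9; linarith
    linarith
  rw [mul_div_assoc', div_le_div_iff_of_pos_right hx]
  nlinarith [logPlus_pos x]

/-- `1 / x ≤ 4 · log₊² x / x`. [folklore] -/
private theorem one_div_le {x : ℝ} (hx : 0 < x) : 1 / x ≤ 4 * (logPlus x ^ 2 / x) := by
  have hL : 1 / 2 ≤ logPlus x := by
    have h := log_two_le_logPlus x
    have h2 : (1 / 2 : ℝ) ≤ Real.log 2 := by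
      have := Real.log_two_gt_d9; linarith
    linarith
  rw [mul_div_assoc', div_le_div_iff_of_pos_right hx]
  nlinarith [logPlus_pos x]

/-- `log x ≤ log₊ x` and, for `x ≥ 0`, `log₊ x = log (2 + x)`. [folklore] -/
private theorem logPlus_of_nonneg {x : ℝ} (hx : 0 ≤ x) : logPlus x = Real.log (2 + x) := by
  rw [logPlus_eq, abs_of_nonneg hx]

/-! ## §2 The exact saddle point at `t = 0` and a priori bounds in the strip -/

/-- The strip `0 ≤ Im w < π/8`, unfolded. [cite: RodgersTaoFMP2020, §2 eq. (21) (FMP p. 12)] -/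
theorem strip_im {w : ℂ} (hw : w ∈ rodgersTaoStrip) : 0 ≤ w.im ∧ w.im < π / 8 := hw

/-- `‖e^{c w}‖ = e^{c Re w}` for real `c`. [folklore] -/
private theorem norm_cexp_ofReal_mul (c : ℝ) (w : ℂ) : ‖cexp (c * w)‖ = Real.exp (c * w.re) := by
  rw [Complex.norm_exp]
  simp

/-- The `t = 0` saddle point `w₁ = ¼ Log(ζ/4π)` solves `4π e^{4w₁} = ζ`. [cite: RodgersTaoFMP2020, §2 eq. (23) (FMP p. 12)] -/
theorem four_pi_mul_cexp_w1 {ζ : ℂ} (hζ : ζ ≠ 0) :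
    4 * (π : ℂ) * cexp (4 * (1 / 4 * Complex.log (ζ / (4 * π)))) = ζ := by
  have hπ : (π : ℂ) ≠ 0 := by exact_mod_cast Real.pi_pos.ne'
  have h4π : (4 : ℂ) * π ≠ 0 := mul_ne_zero (by norm_num) hπ
  have h1 : 4 * (1 / 4 * Complex.log (ζ / (4 * π))) = Complex.log (ζ / (4 * π)) := by ring
  rw [h1, Complex.exp_log (div_ne_zero hζ h4π)]
  field_simp

/-- The `t = 0` saddle point lies in the strip when `Re ζ > 0`, `Im ζ ≥ 0`: `0 ≤ Im w₁ < π/8`.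
[cite: RodgersTaoFMP2020, §2 eq. (21) (FMP p. 12)] -/
theorem w1_im_bounds {ζ : ℂ} (hre : 0 < ζ.re) (him : 0 ≤ ζ.im) :
    0 ≤ (1 / 4 * Complex.log (ζ / (4 * π))).im ∧
      (1 / 4 * Complex.log (ζ / (4 * π))).im < π / 8 := by
  have hπ : 0 < (4 : ℝ) * π := by positivity
  have h4π : (4 : ℂ) * π = ((4 * π : ℝ) : ℂ) := by push_cast; ring
  have hre' : 0 < (ζ / (4 * π)).re := by
    rw [h4π, Complex.div_ofReal_re]; exact div_pos hre hπ
  have him' : 0 ≤ (ζ / (4 * π)).im := by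
    rw [h4π, Complex.div_ofReal_im]; exact div_nonneg him hπ.le
  have him4 : (1 / 4 * Complex.log (ζ / (4 * π))).im = Complex.arg (ζ / (4 * π)) / 4 := by
    have : (1 / 4 : ℂ) = ((1 / 4 : ℝ) : ℂ) := by push_cast; ring
    rw [this, Complex.im_ofReal_mul, Complex.log_im]
    ring
  rw [him4]
  have h1 : 0 ≤ Complex.arg (ζ / (4 * π)) := Complex.arg_nonneg_iff.2 him'
  have h2 : |Complex.arg (ζ / (4 * π))| < π / 2 :=
    Complex.abs_arg_lt_pi_div_two_iff.2 (Or.inl hre')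
  rw [abs_of_nonneg h1] at h2
  constructor
  · linarith
  · linarith

/-- `‖w₁‖ ≤ ¼ (log₊ x + π)` when `x/(4π) ≥ 1`... precisely: if `4π ≤ ‖ζ‖ ≤ 3 x` and `x ≥ 1` then
`‖¼ Log(ζ/4π)‖ ≤ ¼ (log₊ x + log 3 + π)`. [folklore] -/
private theorem norm_w1_le {ζ : ℂ} {x : ℝ} (hx : 1 ≤ x) (hζl : 4 * π ≤ ‖ζ‖) (hζu : ‖ζ‖ ≤ 3 * x) :
    ‖1 / 4 * Complex.log (ζ / (4 * π))‖ ≤ 1 / 4 * (logPlus x + Real.log 3 + π) := by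
  have hπ : 0 < (4 : ℝ) * π := by positivity
  have hn : ‖ζ / (4 * π)‖ = ‖ζ‖ / (4 * π) := by
    rw [norm_div]
    congr 1
    rw [show (4 : ℂ) * π = ((4 * π : ℝ) : ℂ) by push_cast; ring, Complex.norm_real,
      Real.norm_of_nonneg hπ.le]
  have hq1 : 1 ≤ ‖ζ‖ / (4 * π) := by rwa [le_div_iff₀ hπ, one_mul]
  have hlog0 : 0 ≤ Real.log (‖ζ‖ / (4 * π)) := Real.log_nonneg hq1
  have hlogu : Real.log (‖ζ‖ / (4 * π)) ≤ logPlus x + Real.log 3 := by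
    have h1 : ‖ζ‖ / (4 * π) ≤ 3 * x := by
      rw [div_le_iff₀ hπ]
      have : 3 * x ≤ 3 * x * (4 * π) := by
        have hp : (1 : ℝ) ≤ 4 * π := by linarith [Real.pi_gt_three]
        nlinarith
      linarith
    have h2 : Real.log (‖ζ‖ / (4 * π)) ≤ Real.log (3 * x) :=
      Real.log_le_log (by linarith) h1
    rw [Real.log_mul (by norm_num) (by linarith)] at h2
    have h3 : Real.log x ≤ logPlus x := log_le_logPlus x
    linarith
  rw [norm_mul, show ‖(1 / 4 : ℂ)‖ = 1 / 4 by norm_num]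
  refine mul_le_mul_of_nonneg_left ?_ (by norm_num)
  calc ‖Complex.log (ζ / (4 * π))‖ ≤ |Real.log ‖ζ / (4 * π)‖| + π := norm_log_le _
    _ = Real.log (‖ζ‖ / (4 * π)) + π := by rw [hn, abs_of_nonneg hlog0]
    _ ≤ logPlus x + Real.log 3 + π := by linarith

/-! ## §3 A priori bounds for strip solutions of the saddle-point equation and the perturbation
`w₀(t) = w₁ + O(|t| log₊ x / x)` -/

/-- From the saddle-point equation: `‖ζ + 2tw‖ = 4π e^{4 Re w}`. [cite: RodgersTaoFMP2020, §2 eq. (23) (FMP p. 12)] -/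
theorem norm_eq_of_saddleEq {t : ℝ} {ζ w : ℂ} (hE : rodgersTaoSaddleEq t π ζ w) :
    ‖ζ + 2 * (t : ℂ) * w‖ = 4 * π * Real.exp (4 * w.re) := by
  change 4 * (π : ℂ) * cexp (4 * w) = ζ + 2 * t * w at hE
  rw [← hE, norm_mul, norm_mul, show ‖(4 : ℂ)‖ = 4 by norm_num, Complex.norm_real,
    Real.norm_of_nonneg Real.pi_pos.le, show (4 : ℂ) * w = ((4 : ℝ) : ℂ) * w by push_cast; ring,
    norm_cexp_ofReal_mul]

/-- `‖π e^{4w}‖ = π e^{4 Re w}`. [folklore] -/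
private theorem norm_pi_mul_cexp (w : ℂ) : ‖(π : ℂ) * cexp (4 * w)‖ = π * Real.exp (4 * w.re) := by
  rw [norm_mul, Complex.norm_real, Real.norm_of_nonneg Real.pi_pos.le,
    show (4 : ℂ) * w = ((4 : ℝ) : ℂ) * w by push_cast; ring, norm_cexp_ofReal_mul]

/-- In the strip, `Im(ζ + 2tw) ≥ Im ζ − T₀π/4` for `−T₀ ≤ t ≤ 0`. [folklore] -/
private theorem im_add_two_mul_ge {T₀ t : ℝ} (ht : t ∈ Icc (-T₀) 0) {w : ℂ} (hw : w ∈ rodgersTaoStrip)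
    (ζ : ℂ) : ζ.im - T₀ * π / 4 ≤ (ζ + 2 * (t : ℂ) * w).im := by
  obtain ⟨hwim0, hwim1⟩ := strip_im hw
  have h1 : (ζ + 2 * (t : ℂ) * w).im = ζ.im + 2 * (t * w.im) := by
    simp; ring
  rw [h1]
  have h2 : -T₀ * w.im ≤ t * w.im := mul_le_mul_of_nonneg_right ht.1 hwim0
  have h3 : -T₀ * (π / 8) ≤ -T₀ * w.im := by
    have hT : 0 ≤ T₀ := by linarith [ht.1, ht.2]
    have := mul_le_mul_of_nonpos_left hwim1.le (neg_nonpos.2 hT)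
    linarith
  linarith

/-- **A priori bounds** for a strip solution `w` of `4π e^{4w} = ζ + 2tw` (`−T₀ ≤ t ≤ 0`,
`‖ζ‖ ≤ 3 Im ζ`, `Im ζ` large): `‖π e^{4w}‖ ≥ Im ζ / 8`, `0 ≤ Re w` and `‖w‖ ≤ K log₊(Im ζ)`.
[cite: RodgersTaoFMP2020, Lemma 2.3 (FMP Lemma 6 p. 12)] -/
theorem saddle_apriori (T₀ : ℝ) (hT₀ : 0 ≤ T₀) :
    ∃ X K : ℝ, 0 < X ∧ 0 < K ∧ ∀ t ∈ Icc (-T₀) 0, ∀ ζ w : ℂ,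
      ‖ζ‖ ≤ 3 * ζ.im → X ≤ ζ.im → w ∈ rodgersTaoStrip → rodgersTaoSaddleEq t π ζ w →
        ζ.im / 8 ≤ ‖(π : ℂ) * cexp (4 * w)‖ ∧ 0 ≤ w.re ∧ ‖w‖ ≤ K * logPlus ζ.im := by
  set K₁ : ℝ := 1 + T₀ + T₀ ^ 2 with hK₁
  have hK₁1 : 1 ≤ K₁ := by
    simp only [hK₁]; nlinarith
  set Kw : ℝ := Real.log K₁ / 2 + π / 4 + 1 / 4 with hKw
  have hlogK : 0 ≤ Real.log K₁ := Real.log_nonneg hK₁1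
  have hKw0 : 0 < Kw := by simp only [hKw]; positivity
  refine ⟨8 * π + T₀ * π / 2 + 1, Kw, by positivity, hKw0, ?_⟩
  intro t ht ζ w hζ3 hx hw hE
  set x : ℝ := ζ.im with hxdef
  have hπ : 0 < π := Real.pi_pos
  have hx1 : 1 ≤ x := by nlinarith [hπ]
  have hx0 : 0 < x := by linarith
  obtain ⟨hwim0, hwim1⟩ := strip_im hw
  set a : ℝ := w.re with hadef
  have hnormE := norm_eq_of_saddleEq hE
  have hIm := im_add_two_mul_ge ht hw ζ
  have hNlow : x / 2 ≤ ‖ζ + 2 * (t : ℂ) * w‖ := by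
    have h1 := im_le_norm (ζ + 2 * (t : ℂ) * w)
    have h2 : T₀ * π / 4 ≤ x / 2 := by linarith
    linarith
  have hC1 : x / 8 ≤ ‖(π : ℂ) * cexp (4 * w)‖ := by
    rw [norm_pi_mul_cexp]
    have : 4 * π * Real.exp (4 * a) ≥ x / 2 := by rw [← hnormE]; exact hNlow
    linarith
  have hexp4a_ge : 1 ≤ Real.exp (4 * a) := by
    have hT₀π : 0 ≤ T₀ * π := by positivity
    have h1 : 4 * π ≤ 4 * π * Real.exp (4 * a) := by
      rw [← hnormE]; linarith only [hNlow, hx, hT₀π]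
    have h2 : 4 * π * 1 ≤ 4 * π * Real.exp (4 * a) := by linarith
    exact le_of_mul_le_mul_left h2 (by positivity)
  have ha0 : 0 ≤ a := by
    by_contra h
    rw [not_le] at h
    have : Real.exp (4 * a) < 1 := by
      rw [← Real.exp_zero]; exact Real.exp_strictMono (by linarith)
    linarith
  have hw_le : ‖w‖ ≤ a + π / 8 := by
    calc ‖w‖ ≤ |w.re| + |w.im| := norm_le_abs_re_add_abs_im w
      _ ≤ a + π / 8 := by rw [← hadef, abs_of_nonneg ha0, abs_of_nonneg hwim0]; linarith
  have hNup : ‖ζ + 2 * (t : ℂ) * w‖ ≤ 3 * x + 2 * T₀ * (a + π / 8) := by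
    have habs : |t| ≤ T₀ := by rw [abs_of_nonpos ht.2]; linarith [ht.1]
    have h1 : ‖2 * (t : ℂ) * w‖ ≤ 2 * T₀ * (a + π / 8) := by
      rw [norm_mul, norm_mul, show ‖(2 : ℂ)‖ = 2 by norm_num, Complex.norm_real,
        Real.norm_eq_abs]
      have h2 : |t| * ‖w‖ ≤ T₀ * (a + π / 8) :=
        mul_le_mul habs hw_le (norm_nonneg _) hT₀
      linarith
    calc ‖ζ + 2 * (t : ℂ) * w‖ ≤ ‖ζ‖ + ‖2 * (t : ℂ) * w‖ := norm_add_le _ _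
      _ ≤ 3 * x + 2 * T₀ * (a + π / 8) := by linarith
  have h2a : 2 * a ≤ Real.exp (2 * a) := by linarith [Real.add_one_le_exp (2 * a)]
  have hexp4 : Real.exp (4 * a) = Real.exp (2 * a) ^ 2 := by
    rw [sq, ← Real.exp_add]; ring_nf
  have hexp4a_le : Real.exp (4 * a) ≤ K₁ * x := by
    have h1 : 4 * π * Real.exp (4 * a) ≤ 3 * x + 2 * T₀ * (a + π / 8) := by
      rw [← hnormE]; exact hNup
    have h2 : 2 * T₀ * a ≤ T₀ * Real.exp (2 * a) := by
      have := mul_le_mul_of_nonneg_left h2a hT₀; linarith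
    have h3 : T₀ * Real.exp (2 * a) ≤ T₀ ^ 2 / (4 * π) + π * Real.exp (4 * a) := by
      rw [hexp4]
      have h4 : 0 ≤ π * (T₀ / (2 * π) - Real.exp (2 * a)) ^ 2 := by positivity
      have h5 : π * (T₀ / (2 * π) - Real.exp (2 * a)) ^ 2 =
          T₀ ^ 2 / (4 * π) + π * Real.exp (2 * a) ^ 2 - T₀ * Real.exp (2 * a) := by
        field_simp
        ring
      linarith
    have h7 : 3 * π * Real.exp (4 * a) ≤ 3 * x + T₀ * π / 4 + T₀ ^ 2 / (4 * π) := by linarith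
    have h8 : Real.exp (4 * a) ≤ x / π + T₀ / 12 + T₀ ^ 2 / (12 * π ^ 2) := by
      have hπ3 : 0 < 3 * π := by positivity
      rw [show x / π + T₀ / 12 + T₀ ^ 2 / (12 * π ^ 2) =
        (3 * x + T₀ * π / 4 + T₀ ^ 2 / (4 * π)) / (3 * π) by field_simp; ring]
      rw [le_div_iff₀ hπ3]
      linarith
    have h9 : x / π ≤ x := by
      rw [div_le_iff₀ hπ]
      have : x * 1 ≤ x * π := mul_le_mul_of_nonneg_left (by linarith [Real.pi_gt_three]) hx0.le
      linarith
    have h10 : T₀ / 12 ≤ T₀ * x := by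
      have : T₀ * 1 ≤ T₀ * x := mul_le_mul_of_nonneg_left hx1 hT₀
      linarith
    have h11 : T₀ ^ 2 / (12 * π ^ 2) ≤ T₀ ^ 2 * x := by
      rw [div_le_iff₀ (by positivity)]
      have h12 : (1 : ℝ) ≤ 12 * π ^ 2 := by nlinarith [Real.pi_gt_three]
      have h13 : T₀ ^ 2 * 1 ≤ T₀ ^ 2 * x := mul_le_mul_of_nonneg_left hx1 (sq_nonneg _)
      have h14 : T₀ ^ 2 * x * 1 ≤ T₀ ^ 2 * x * (12 * π ^ 2) :=
        mul_le_mul_of_nonneg_left h12 (by positivity)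
      linarith
    calc Real.exp (4 * a) ≤ x / π + T₀ / 12 + T₀ ^ 2 / (12 * π ^ 2) := h8
      _ ≤ x + T₀ * x + T₀ ^ 2 * x := by linarith
      _ = K₁ * x := by simp only [hK₁]; ring
  have hL1 : 1 / 2 ≤ logPlus x := by
    have h := log_two_le_logPlus x
    have h2 : (1 / 2 : ℝ) ≤ Real.log 2 := by have := Real.log_two_gt_d9; linarith
    linarith
  have ha_le : a ≤ (Real.log K₁ + logPlus x) / 4 := by
    have h1 : 4 * a = Real.log (Real.exp (4 * a)) := (Real.log_exp _).symm
    have h2 : Real.log (Real.exp (4 * a)) ≤ Real.log (K₁ * x) :=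
      Real.log_le_log (Real.exp_pos _) hexp4a_le
    rw [Real.log_mul (by positivity) hx0.ne'] at h2
    linarith [log_le_logPlus x]
  have hC2 : ‖w‖ ≤ Kw * logPlus x := by
    have h2 : Real.log K₁ / 4 + π / 8 ≤ (Real.log K₁ / 2 + π / 4) * logPlus x := by
      have : Real.log K₁ / 4 + π / 8 = (Real.log K₁ / 2 + π / 4) * (1 / 2) := by ring
      rw [this]
      exact mul_le_mul_of_nonneg_left hL1 (by positivity)
    calc ‖w‖ ≤ a + π / 8 := hw_le
      _ ≤ (Real.log K₁ + logPlus x) / 4 + π / 8 := by linarith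
      _ = (Real.log K₁ / 4 + π / 8) + logPlus x / 4 := by ring
      _ ≤ (Real.log K₁ / 2 + π / 4) * logPlus x + logPlus x / 4 := by linarith
      _ = Kw * logPlus x := by simp only [hKw]; ring
  exact ⟨hC1, ha0, hC2⟩

/-- **Saddle-point perturbation** (the quantitative content behind "sending `t` to `0`" on
FMP p. 19, for the `n = 1` saddle points of Lemma 2.3 = FMP Lemma 6): under the hypotheses of
`saddle_apriori` (and `Re ζ > 0`), with the `t = 0` saddle point `w₁ = ¼ Log(ζ/4π)`:
`e^{4(w − w₁)} = 1 + 2tw/ζ`, `‖w − w₁‖ ≤ K log₊ x / x`, `‖4(w − w₁)‖ ≤ 1`, and the phase comparison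
`(tw² − πe^{4w} + ζw − 2w) − (−ζ/4 + (ζ − 2)w₁ + t w₁²) = O(log₊² x / x)` (first-order
stationarity of the `t = 0` phase at `w₁`). [cite: RodgersTaoFMP2020, Lemma 2.3 and §2 p. 19 (FMP Lemma 6 p. 12)] -/
theorem saddle_perturbation (T₀ : ℝ) (hT₀ : 0 ≤ T₀) :
    ∃ X K : ℝ, 0 < X ∧ 0 < K ∧ ∀ t ∈ Icc (-T₀) 0, ∀ ζ w : ℂ,
      0 < ζ.re → ‖ζ‖ ≤ 3 * ζ.im → X ≤ ζ.im →
      w ∈ rodgersTaoStrip → rodgersTaoSaddleEq t π ζ w →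
        ζ.im / 8 ≤ ‖(π : ℂ) * cexp (4 * w)‖ ∧
        ‖w‖ ≤ K * logPlus ζ.im ∧
        ‖w - 1 / 4 * Complex.log (ζ / (4 * π))‖ ≤ K * logPlus ζ.im / ζ.im ∧
        ‖(t * w ^ 2 - π * cexp (4 * w) + ζ * w - 2 * w) -
            (-ζ / 4 + (ζ - 2) * (1 / 4 * Complex.log (ζ / (4 * π))) +
              t * (1 / 4 * Complex.log (ζ / (4 * π))) ^ 2)‖ ≤ K * logPlus ζ.im ^ 2 / ζ.im := by
  obtain ⟨X₀, Kw, hX₀, hKw0, hap⟩ := saddle_apriori T₀ hT₀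
  -- constants
  set Kδ : ℝ := T₀ * Kw with hKδ
  have hKδ0 : 0 ≤ Kδ := by positivity
  set Kw1 : ℝ := 1 / 4 * (1 + 2 * Real.log 3 + 2 * π) with hKw1
  have hlog3 : 0 ≤ Real.log 3 := Real.log_nonneg (by norm_num)
  have hKw10 : 0 < Kw1 := by simp only [hKw1]; positivity
  set Kr : ℝ := T₀ * Kδ * (2 * Kw1 + Kδ) + 12 * Kδ ^ 2 + 4 * Kδ with hKr
  have hKr0 : 0 ≤ Kr := by positivity
  set ε₁ : ℝ := 1 / (4 * (2 * T₀ * Kw + 1)) with hε₁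
  have hε₁0 : 0 < ε₁ := by positivity
  set X : ℝ := max (max X₀ (4 * π + 1)) ((28 / ε₁) ^ 2) with hX
  set K : ℝ := Kw + Kδ + Kr + 1 with hK
  refine ⟨X, K, lt_of_lt_of_le hX₀ ((le_max_left _ _).trans (le_max_left _ _)), by positivity, ?_⟩
  intro t ht ζ w hre hζ3 hx hw hE
  have hxX₀ : X₀ ≤ ζ.im := le_trans ((le_max_left _ _).trans (le_max_left _ _)) hx
  have hx4π : 4 * π + 1 ≤ ζ.im := le_trans ((le_max_right _ _).trans (le_max_left _ _)) hx
  have hX2 : (28 / ε₁) ^ 2 ≤ ζ.im := le_trans (le_max_right _ _) hx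
  obtain ⟨hC1, ha0, hwK⟩ := hap t ht ζ w hζ3 hxX₀ hw hE
  set x : ℝ := ζ.im with hxdef
  have hπ : 0 < π := Real.pi_pos
  have hx1 : 1 ≤ x := by linarith only [hπ, hx4π]
  have hx0 : 0 < x := by linarith only [hx1]
  obtain ⟨hwim0, hwim1⟩ := strip_im hw
  have hζ0 : ζ ≠ 0 := fun h ↦ by rw [h] at hre; simp at hre
  have hζx : x ≤ ‖ζ‖ := by
    have := abs_im_le_norm ζ; rwa [← hxdef, abs_of_pos hx0] at this
  have hE' : 4 * (π : ℂ) * cexp (4 * w) = ζ + 2 * t * w := hE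
  have hL1 : 1 / 2 ≤ logPlus x := by
    have h := log_two_le_logPlus x
    have h2 : (1 / 2 : ℝ) ≤ Real.log 2 := by have := Real.log_two_gt_d9; linarith only [this]
    linarith only [h, h2]
  have hKwK : Kw ≤ K := by simp only [hK]; linarith only [hKδ0, hKr0]
  have hC2 : ‖w‖ ≤ K * logPlus x :=
    hwK.trans (mul_le_mul_of_nonneg_right hKwK (logPlus_nonneg x))
  -- the perturbation `δ = w − w₁`
  set w₁ : ℂ := 1 / 4 * Complex.log (ζ / (4 * π)) with hw₁
  set δ : ℂ := w - w₁ with hδ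
  have hw1E : 4 * (π : ℂ) * cexp (4 * w₁) = ζ := four_pi_mul_cexp_w1 hζ0
  obtain ⟨hw1im0, hw1im1⟩ := w1_im_bounds hre hx0.le
  have hπc : (π : ℂ) ≠ 0 := by exact_mod_cast hπ.ne'
  set u : ℂ := 2 * (t : ℂ) * w / ζ with hu
  have hexpw : cexp (4 * w) = (ζ + 2 * t * w) / (4 * π) := by
    rw [← hE']; field_simp
  have hexpw1 : cexp (4 * w₁) = ζ / (4 * π) := by
    rw [← hw1E]; field_simp
  have hexpδ : cexp (4 * δ) = 1 + u := by
    have h1 : cexp (4 * δ) = cexp (4 * w) / cexp (4 * w₁) := by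
      rw [hδ, ← Complex.exp_sub]; ring_nf
    rw [h1, hexpw, hexpw1, hu]
    field_simp
  -- smallness of `u`
  have hLsq : logPlus x ^ 2 / x ≤ ε₁ := logPlus_sq_div_le_of_le hε₁0 hx1 hX2
  have hLx : logPlus x / x ≤ 2 * ε₁ := (logPlus_div_le hx0).trans (by linarith only [hLsq])
  have habs : |t| ≤ T₀ := by rw [abs_of_nonpos ht.2]; linarith only [ht.1]
  have hu_le : ‖u‖ ≤ 2 * T₀ * Kw * (logPlus x / x) := by
    have h1 : ‖u‖ = 2 * |t| * ‖w‖ / ‖ζ‖ := by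
      rw [hu, norm_div, norm_mul, norm_mul, show ‖(2 : ℂ)‖ = 2 by norm_num, Complex.norm_real,
        Real.norm_eq_abs]
    rw [h1, div_le_iff₀ (norm_pos_iff.2 hζ0)]
    have h2 : |t| * ‖w‖ ≤ T₀ * (Kw * logPlus x) := mul_le_mul habs hwK (norm_nonneg _) hT₀
    have h3 : 2 * T₀ * Kw * (logPlus x / x) * ‖ζ‖ ≥ 2 * T₀ * Kw * (logPlus x / x) * x :=
      mul_le_mul_of_nonneg_left hζx (by positivity)
    have h4 : 2 * T₀ * Kw * (logPlus x / x) * x = 2 * (T₀ * (Kw * logPlus x)) := by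
      field_simp
    linarith only [h2, h3, h4]
  have hu_half : ‖u‖ ≤ 1 / 2 := by
    have h1 : ‖u‖ ≤ 2 * T₀ * Kw * (2 * ε₁) :=
      hu_le.trans (mul_le_mul_of_nonneg_left hLx (by positivity))
    have h2 : 2 * T₀ * Kw * (2 * ε₁) ≤ 1 / 2 := by
      have e : 2 * T₀ * Kw * (2 * ε₁) = (2 * T₀ * Kw) / (2 * (2 * T₀ * Kw + 1)) := by
        simp only [hε₁]; field_simp; ring
      rw [e, div_le_iff₀ (by positivity)]
      have : 0 ≤ T₀ * Kw := by positivity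
      linarith only [this]
    linarith only [h1, h2]
  -- `4δ = Log(1 + u)`
  have h4δim : (4 * δ).im = 4 * (w.im - w₁.im) := by
    have : (4 * δ).im = 4 * δ.im := by simp
    rw [this, hδ, Complex.sub_im]
  have h4δ : 4 * δ = Complex.log (1 + u) := by
    rw [← hexpδ, Complex.log_exp]
    · rw [h4δim]; linarith only [hwim0, hwim1, hw1im0, hw1im1, hπ]
    · rw [h4δim]; linarith only [hwim0, hwim1, hw1im0, hw1im1, hπ]
  have h4δ_le : ‖4 * δ‖ ≤ 3 / 2 * ‖u‖ := by
    rw [h4δ]; exact Complex.norm_log_one_add_half_le_self hu_half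
  have hnorm4δ : ‖4 * δ‖ = 4 * ‖δ‖ := by rw [norm_mul]; norm_num
  have hδ_le : ‖δ‖ ≤ Kδ * (logPlus x / x) := by
    have h2 : ‖δ‖ ≤ 3 / 8 * ‖u‖ := by rw [hnorm4δ] at h4δ_le; linarith only [h4δ_le]
    have h3 : 3 / 8 * ‖u‖ ≤ 3 / 8 * (2 * T₀ * Kw * (logPlus x / x)) :=
      mul_le_mul_of_nonneg_left hu_le (by norm_num)
    have h4 : 3 / 8 * (2 * T₀ * Kw * (logPlus x / x)) ≤ Kδ * (logPlus x / x) := by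
      simp only [hKδ]
      have : 0 ≤ T₀ * Kw * (logPlus x / x) := by positivity
      linarith only [this]
    linarith only [h2, h3, h4]
  -- conclusion 3
  have hC3 : ‖w - w₁‖ ≤ K * logPlus x / x := by
    rw [← hδ]
    calc ‖δ‖ ≤ Kδ * (logPlus x / x) := hδ_le
      _ ≤ K * (logPlus x / x) := by
          refine mul_le_mul_of_nonneg_right ?_ (by positivity)
          simp only [hK]; linarith only [hKw0, hKr0]
      _ = K * logPlus x / x := by ring
  -- conclusion 4: the phase comparison
  have hζ4π : 4 * π ≤ ‖ζ‖ := by linarith only [hx4π, hζx, hxdef]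
  have hw1_le : ‖w₁‖ ≤ Kw1 * logPlus x := by
    have h1 := norm_w1_le hx1 hζ4π hζ3
    calc ‖w₁‖ ≤ 1 / 4 * (logPlus x + Real.log 3 + π) := h1
      _ ≤ 1 / 4 * (logPlus x + (2 * Real.log 3 + 2 * π) * logPlus x) := by
          have h3 : Real.log 3 + π ≤ (2 * Real.log 3 + 2 * π) * logPlus x := by
            have e : Real.log 3 + π = (2 * Real.log 3 + 2 * π) * (1 / 2) := by ring
            rw [e]; exact mul_le_mul_of_nonneg_left hL1 (by positivity)
          linarith only [h3]
      _ = Kw1 * logPlus x := by simp only [hKw1]; ring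
  have hpe : (π : ℂ) * cexp (4 * w) = ζ / 4 * cexp (4 * δ) := by
    have h1 : cexp (4 * w) = cexp (4 * w₁) * cexp (4 * δ) := by
      rw [← Complex.exp_add, hδ]; ring_nf
    rw [h1, hexpw1]; field_simp
  have hident : (t * w ^ 2 - π * cexp (4 * w) + ζ * w - 2 * w) -
      (-ζ / 4 + (ζ - 2) * w₁ + t * w₁ ^ 2) =
      t * δ * (2 * w₁ + δ) - ζ / 4 * (cexp (4 * δ) - 1 - 4 * δ) - 2 * δ := by
    rw [hpe, hδ]; ring
  have h4δ1 : ‖4 * δ‖ ≤ 1 := by linarith only [h4δ_le, hu_half, norm_nonneg u]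
  have hexp_est : ‖cexp (4 * δ) - 1 - 4 * δ‖ ≤ ‖4 * δ‖ ^ 2 :=
    Complex.norm_exp_sub_one_sub_id_le h4δ1
  set D : ℝ := logPlus x / x with hD
  have hD0 : 0 ≤ D := by positivity
  have hDle : D ≤ logPlus x := by
    simp only [hD]; rw [div_le_iff₀ hx0]
    have := mul_le_mul_of_nonneg_left hx1 (logPlus_nonneg x)
    linarith only [this]
  have hKD : 0 ≤ Kδ * D := by positivity
  -- term 1
  have hT1 : ‖(t : ℂ) * δ * (2 * w₁ + δ)‖ ≤ T₀ * (Kδ * D) * (2 * Kw1 * logPlus x + Kδ * D) := by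
    rw [norm_mul, norm_mul, Complex.norm_real, Real.norm_eq_abs]
    have h1 : ‖2 * w₁ + δ‖ ≤ 2 * Kw1 * logPlus x + Kδ * D := by
      calc ‖2 * w₁ + δ‖ ≤ ‖2 * w₁‖ + ‖δ‖ := norm_add_le _ _
        _ ≤ 2 * Kw1 * logPlus x + Kδ * D := by
            rw [norm_mul, show ‖(2 : ℂ)‖ = 2 by norm_num]; linarith only [hw1_le, hδ_le]
    have h2 : |t| * ‖δ‖ ≤ T₀ * (Kδ * D) := mul_le_mul habs hδ_le (norm_nonneg _) hT₀
    calc |t| * ‖δ‖ * ‖2 * w₁ + δ‖ ≤ T₀ * (Kδ * D) * ‖2 * w₁ + δ‖ :=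
          mul_le_mul_of_nonneg_right h2 (norm_nonneg _)
      _ ≤ T₀ * (Kδ * D) * (2 * Kw1 * logPlus x + Kδ * D) :=
          mul_le_mul_of_nonneg_left h1 (by positivity)
  -- term 2
  have hT2 : ‖ζ / 4 * (cexp (4 * δ) - 1 - 4 * δ)‖ ≤ 12 * x * (Kδ * D) ^ 2 := by
    rw [norm_mul, norm_div, show ‖(4 : ℂ)‖ = 4 by norm_num]
    have h1 : ‖4 * δ‖ ^ 2 ≤ 16 * (Kδ * D) ^ 2 := by
      rw [hnorm4δ]
      have h2 : (4 * ‖δ‖) ^ 2 = 16 * ‖δ‖ ^ 2 := by ring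
      rw [h2]
      have h3 : ‖δ‖ ^ 2 ≤ (Kδ * D) ^ 2 := pow_le_pow_left₀ (norm_nonneg _) hδ_le 2
      linarith only [h3]
    calc ‖ζ‖ / 4 * ‖cexp (4 * δ) - 1 - 4 * δ‖ ≤ ‖ζ‖ / 4 * ‖4 * δ‖ ^ 2 :=
          mul_le_mul_of_nonneg_left hexp_est (by positivity)
      _ ≤ (3 * x) / 4 * (16 * (Kδ * D) ^ 2) :=
          mul_le_mul (by linarith only [hζ3]) h1 (by positivity) (by positivity)
      _ = 12 * x * (Kδ * D) ^ 2 := by ring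
  -- term 3
  have hT3 : ‖2 * δ‖ ≤ 2 * (Kδ * D) := by
    rw [norm_mul, show ‖(2 : ℂ)‖ = 2 by norm_num]; linarith only [hδ_le]
  have hsum : ‖(t : ℂ) * δ * (2 * w₁ + δ) - ζ / 4 * (cexp (4 * δ) - 1 - 4 * δ) - 2 * δ‖ ≤
      T₀ * (Kδ * D) * (2 * Kw1 * logPlus x + Kδ * D) + 12 * x * (Kδ * D) ^ 2 + 2 * (Kδ * D) := by
    have h1 := norm_sub_le ((t : ℂ) * δ * (2 * w₁ + δ) - ζ / 4 * (cexp (4 * δ) - 1 - 4 * δ))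
      (2 * δ)
    have h2 := norm_sub_le ((t : ℂ) * δ * (2 * w₁ + δ)) (ζ / 4 * (cexp (4 * δ) - 1 - 4 * δ))
    linarith only [h1, h2, hT1, hT2, hT3]
  have hb1 : T₀ * (Kδ * D) * (2 * Kw1 * logPlus x + Kδ * D) ≤
      T₀ * Kδ * (2 * Kw1 + Kδ) * (logPlus x ^ 2 / x) := by
    have e : logPlus x ^ 2 / x = D * logPlus x := by simp only [hD]; field_simp
    rw [e]
    have h1 : 2 * Kw1 * logPlus x + Kδ * D ≤ (2 * Kw1 + Kδ) * logPlus x := by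
      have := mul_le_mul_of_nonneg_left hDle hKδ0
      linarith only [this]
    calc T₀ * (Kδ * D) * (2 * Kw1 * logPlus x + Kδ * D)
        ≤ T₀ * (Kδ * D) * ((2 * Kw1 + Kδ) * logPlus x) :=
          mul_le_mul_of_nonneg_left h1 (by positivity)
      _ = T₀ * Kδ * (2 * Kw1 + Kδ) * (D * logPlus x) := by ring
  have hb2 : 12 * x * (Kδ * D) ^ 2 = 12 * Kδ ^ 2 * (logPlus x ^ 2 / x) := by
    simp only [hD]; field_simp
  have hb3 : 2 * (Kδ * D) ≤ 4 * Kδ * (logPlus x ^ 2 / x) := by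
    have h1 : D ≤ 2 * (logPlus x ^ 2 / x) := logPlus_div_le hx0
    have := mul_le_mul_of_nonneg_left h1 hKδ0
    linarith only [this]
  have hfinal : T₀ * (Kδ * D) * (2 * Kw1 * logPlus x + Kδ * D) + 12 * x * (Kδ * D) ^ 2 +
      2 * (Kδ * D) ≤ Kr * (logPlus x ^ 2 / x) := by
    rw [hb2]
    have e : Kr * (logPlus x ^ 2 / x) = T₀ * Kδ * (2 * Kw1 + Kδ) * (logPlus x ^ 2 / x) +
        12 * Kδ ^ 2 * (logPlus x ^ 2 / x) + 4 * Kδ * (logPlus x ^ 2 / x) := by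
      simp only [hKr]; ring
    rw [e]; linarith only [hb1, hb3]
  have hC4 : ‖(t * w ^ 2 - π * cexp (4 * w) + ζ * w - 2 * w) -
      (-ζ / 4 + (ζ - 2) * w₁ + t * w₁ ^ 2)‖ ≤ K * logPlus x ^ 2 / x := by
    rw [hident]
    have hKrK : Kr * (logPlus x ^ 2 / x) ≤ K * (logPlus x ^ 2 / x) :=
      mul_le_mul_of_nonneg_right (by simp only [hK]; linarith only [hKw0, hKδ0]) (by positivity)
    calc _ ≤ _ := hsum
      _ ≤ Kr * (logPlus x ^ 2 / x) := hfinal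
      _ ≤ K * (logPlus x ^ 2 / x) := hKrK
      _ = K * logPlus x ^ 2 / x := by ring
  exact ⟨hC1, hC2, hC3, hC4⟩

/-! ## §4 From the stationary-phase asymptotic (31) to the exponential form of `I_t(π, ζ)` -/

/-- In the strip, `(π e^{4w})^{−1/2} = exp(−½ log π − 2w)` (principal branch; `Im(4w) ∈ [0, π/2)`).
[folklore] -/
private theorem cpow_neg_half_eq {w : ℂ} (hw : w ∈ rodgersTaoStrip) :
    ((π : ℂ) * cexp (4 * w)) ^ (-(1 / 2 : ℂ)) =
      cexp (-((Real.log π / 2 : ℝ) : ℂ) - 2 * w) := by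
  obtain ⟨hwim0, hwim1⟩ := strip_im hw
  have hπ : 0 < π := Real.pi_pos
  have hv : (π : ℂ) * cexp (4 * w) = cexp ((Real.log π : ℂ) + 4 * w) := by
    rw [Complex.exp_add, ← Complex.ofReal_exp, Real.exp_log hπ]
  have hne : (π : ℂ) * cexp (4 * w) ≠ 0 :=
    mul_ne_zero (by exact_mod_cast hπ.ne') (Complex.exp_ne_zero _)
  rw [Complex.cpow_def_of_ne_zero hne, hv, Complex.log_exp]
  · congr 1
    push_cast
    ring
  · have : ((Real.log π : ℂ) + 4 * w).im = 4 * w.im := by simp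
    rw [this]; linarith
  · have : ((Real.log π : ℂ) + 4 * w).im = 4 * w.im := by simp
    rw [this]; linarith

/-- `‖π e^{4w}‖^{3/2} = √π · e^{2 Re w} · ‖π e^{4w}‖`. [folklore] -/
private theorem norm_pi_mul_cexp_rpow (w : ℂ) :
    ‖(π : ℂ) * cexp (4 * w)‖ ^ (3 / 2 : ℝ) =
      Real.sqrt π * Real.exp (2 * w.re) * ‖(π : ℂ) * cexp (4 * w)‖ := by
  have hπ : 0 < π := Real.pi_pos
  set N : ℝ := ‖(π : ℂ) * cexp (4 * w)‖ with hN
  have hNeq : N = π * Real.exp (4 * w.re) := norm_pi_mul_cexp w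
  have hNpos : 0 < N := by rw [hNeq]; positivity
  have h1 : N ^ (3 / 2 : ℝ) = N * Real.sqrt N := by
    rw [show (3 / 2 : ℝ) = 1 + 1 / 2 by norm_num, Real.rpow_add hNpos, Real.rpow_one,
      Real.sqrt_eq_rpow]
  have h2 : Real.sqrt N = Real.sqrt π * Real.exp (2 * w.re) := by
    rw [hNeq, show Real.exp (4 * w.re) = Real.exp (2 * w.re) ^ 2 by
      rw [sq, ← Real.exp_add]; ring_nf, Real.sqrt_mul hπ.le, Real.sqrt_sq (Real.exp_pos _).le]
  rw [h1, h2]; ring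

/-- **From (31) to the exponential form.** If `w` is in the strip with `‖π e^{4w}‖ ≥ x/8` and
`I` satisfies the (31)-shaped estimate with constant `A`, then
`‖I − c₀ e^{Ψ}‖ ≤ (8A/√π) ‖e^{Ψ}‖ / x` with `Ψ = tw² − πe^{4w} + ζw − 2w` and the positive constant
`c₀ = √(π/8) e^{−½ log π}` (`= 8^{−1/2}`). [cite: RodgersTaoFMP2020, §2 eq. (31) (FMP p. 16)] -/
theorem exp_form_of_I_asymp {t : ℝ} {ζ w I : ℂ} {A x : ℝ} (hA : 0 ≤ A) (hx : 0 < x)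
    (hw : w ∈ rodgersTaoStrip) (hlow : x / 8 ≤ ‖(π : ℂ) * cexp (4 * w)‖)
    (h31 : ‖I - (Real.sqrt (π / 8) : ℂ) * cexp (t * w ^ 2 - π * cexp (4 * w) + ζ * w) *
        ((π : ℂ) * cexp (4 * w)) ^ (-(1 / 2 : ℂ))‖ ≤
      A * ‖cexp (t * w ^ 2 - π * cexp (4 * w) + ζ * w)‖ /
        ‖(π : ℂ) * cexp (4 * w)‖ ^ (3 / 2 : ℝ)) :
    ‖I - ((Real.sqrt (π / 8) * Real.exp (-(Real.log π / 2)) : ℝ) : ℂ) *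
        cexp (t * w ^ 2 - π * cexp (4 * w) + ζ * w - 2 * w)‖ ≤
      (8 * A / Real.sqrt π) * ‖cexp (t * w ^ 2 - π * cexp (4 * w) + ζ * w - 2 * w)‖ / x := by
  have hπ : 0 < π := Real.pi_pos
  set Φ : ℂ := t * w ^ 2 - π * cexp (4 * w) + ζ * w with hΦ
  set Ψ : ℂ := t * w ^ 2 - π * cexp (4 * w) + ζ * w - 2 * w with hΨ
  set N : ℝ := ‖(π : ℂ) * cexp (4 * w)‖ with hN
  have hNpos : 0 < N := lt_of_lt_of_le (by positivity) hlow
  -- the main term in exponential form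
  have hmain : (Real.sqrt (π / 8) : ℂ) * cexp Φ * ((π : ℂ) * cexp (4 * w)) ^ (-(1 / 2 : ℂ)) =
      ((Real.sqrt (π / 8) * Real.exp (-(Real.log π / 2)) : ℝ) : ℂ) * cexp Ψ := by
    rw [cpow_neg_half_eq hw, mul_assoc, ← Complex.exp_add, Complex.ofReal_mul,
      Complex.ofReal_exp, mul_assoc, ← Complex.exp_add]
    congr 2
    simp only [hΦ, hΨ]
    push_cast
    ring
  rw [← hmain]
  refine h31.trans ?_
  -- the error term
  have hΦΨ : ‖cexp Φ‖ = ‖cexp Ψ‖ * Real.exp (2 * w.re) := by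
    have h1 : Φ = Ψ + 2 * w := by simp only [hΦ, hΨ]; ring
    rw [h1, Complex.exp_add, norm_mul, show (2 : ℂ) * w = ((2 : ℝ) : ℂ) * w by push_cast; ring,
      norm_cexp_ofReal_mul]
  rw [norm_pi_mul_cexp_rpow w, ← hN, hΦΨ]
  have hsπ : 0 < Real.sqrt π := Real.sqrt_pos.2 hπ
  have he : 0 < Real.exp (2 * w.re) := Real.exp_pos _
  have hkey : A * (‖cexp Ψ‖ * Real.exp (2 * w.re)) / (Real.sqrt π * Real.exp (2 * w.re) * N) =
      A * ‖cexp Ψ‖ / (Real.sqrt π * N) := by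
    field_simp
  rw [hkey, div_le_div_iff₀ (by positivity) hx]
  have h1 : A * ‖cexp Ψ‖ * x ≤ A * ‖cexp Ψ‖ * (8 * N) := by
    have : x ≤ 8 * N := by linarith
    exact mul_le_mul_of_nonneg_left this (by positivity)
  calc A * ‖cexp Ψ‖ * x ≤ A * ‖cexp Ψ‖ * (8 * N) := h1
    _ = 8 * A / Real.sqrt π * ‖cexp Ψ‖ * (Real.sqrt π * N) := by
        field_simp

/-- **Transfer along the phase comparison.** If `‖I − c e^{Ψ}‖ ≤ K₁ ‖e^Ψ‖/x`, `‖Ψ − g‖ ≤ K₂ E`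
with `K₂ E ≤ 1` and `1/x ≤ 4E` (`E = log₊² x / x`), `c ≥ 0`, then
`‖I − c e^{g}‖ ≤ (12 K₁ + 2 c K₂) E ‖e^{g}‖`. [folklore] -/
private theorem exp_form_transfer {I Ψ g : ℂ} {c K₁ K₂ E x : ℝ} (hc : 0 ≤ c) (hK₁ : 0 ≤ K₁)
    (hx : 0 < x) (hxE : 1 / x ≤ 4 * E)
    (h1 : ‖I - (c : ℂ) * cexp Ψ‖ ≤ K₁ * ‖cexp Ψ‖ / x) (h2 : ‖Ψ - g‖ ≤ K₂ * E)
    (hsmall : K₂ * E ≤ 1) :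
    ‖I - (c : ℂ) * cexp g‖ ≤ (12 * K₁ + 2 * c * K₂) * E * ‖cexp g‖ := by
  have hd1 : ‖Ψ - g‖ ≤ 1 := h2.trans hsmall
  have heg : 0 < ‖cexp g‖ := norm_pos_iff.2 (Complex.exp_ne_zero _)
  have hΨg : cexp Ψ = cexp g * cexp (Ψ - g) := by rw [← Complex.exp_add]; ring_nf
  have hnΨ : ‖cexp Ψ‖ ≤ 3 * ‖cexp g‖ := by
    rw [hΨg, norm_mul]
    have h3 : ‖cexp (Ψ - g)‖ ≤ 3 := by
      rw [Complex.norm_exp]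
      have h5 := Real.exp_le_exp.2 ((Complex.re_le_norm _).trans hd1)
      have h4 : Real.exp 1 ≤ 3 := by
        have := Real.exp_one_lt_d9; linarith
      linarith
    calc ‖cexp g‖ * ‖cexp (Ψ - g)‖ ≤ ‖cexp g‖ * 3 := mul_le_mul_of_nonneg_left h3 (norm_nonneg _)
      _ = 3 * ‖cexp g‖ := by ring
  have hdiff : ‖cexp Ψ - cexp g‖ ≤ ‖cexp g‖ * (2 * (K₂ * E)) := by
    rw [hΨg, ← mul_sub_one, norm_mul]
    refine mul_le_mul_of_nonneg_left ?_ (norm_nonneg _)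
    exact (Complex.norm_exp_sub_one_le hd1).trans (by linarith)
  calc ‖I - (c : ℂ) * cexp g‖ = ‖(I - (c : ℂ) * cexp Ψ) + (c : ℂ) * (cexp Ψ - cexp g)‖ := by
        ring_nf
    _ ≤ ‖I - (c : ℂ) * cexp Ψ‖ + ‖(c : ℂ) * (cexp Ψ - cexp g)‖ := norm_add_le _ _
    _ ≤ K₁ * ‖cexp Ψ‖ / x + c * (‖cexp g‖ * (2 * (K₂ * E))) := by
        rw [norm_mul, Complex.norm_real, Real.norm_of_nonneg hc]
        exact add_le_add h1 (mul_le_mul_of_nonneg_left hdiff hc)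
    _ ≤ K₁ * (3 * ‖cexp g‖) * (4 * E) + c * (‖cexp g‖ * (2 * (K₂ * E))) := by
        have h5 : K₁ * ‖cexp Ψ‖ / x = K₁ * ‖cexp Ψ‖ * (1 / x) := by ring
        rw [h5]
        have h6 : K₁ * ‖cexp Ψ‖ * (1 / x) ≤ K₁ * (3 * ‖cexp g‖) * (1 / x) :=
          mul_le_mul_of_nonneg_right (mul_le_mul_of_nonneg_left hnΨ hK₁) (by positivity)
        have h7 : K₁ * (3 * ‖cexp g‖) * (1 / x) ≤ K₁ * (3 * ‖cexp g‖) * (4 * E) :=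
          mul_le_mul_of_nonneg_left hxE (by positivity)
        linarith
    _ = (12 * K₁ + 2 * c * K₂) * E * ‖cexp g‖ := by ring

/-! ## §5 The explicit phase `g` and the comparison of the two terms of `Q_{t,1}` -/

/-- **The second term of `Q_{t,1}` is `O(1/x)` times the first** at the level of the explicit
phases: for `g(ζ) = −ζ/4 + (ζ − 2)w₁(ζ) + t w₁(ζ)²`, `w₁(ζ) = ¼ Log(ζ/4π)`, and `ζ₂ = ζ − 4`,
`‖e^{g(ζ₂) − g(ζ)}‖ ≤ K_g / Im ζ` (the factor `e^{−4 Re w₁(ζ₂)} = 4π/‖ζ₂‖`; cf. FMP p. 18, the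
`(x/4π)^{(5+y)/4}` versus `(x/4π)^{(9+y)/4}` sizes of the two `I_t`-terms). [cite: RodgersTaoFMP2020, §2 p. 18 (FMP)] -/
theorem norm_cexp_phase_sub_le (T₀ : ℝ) (hT₀ : 0 ≤ T₀) :
    ∃ Kg : ℝ, 0 < Kg ∧ ∀ t ∈ Icc (-T₀) 0, ∀ ζ : ℂ,
      4 < ζ.re → ‖ζ‖ ≤ 2 * ζ.im → 4 * π + 4 ≤ ζ.im →
      ‖cexp ((-(ζ - 4) / 4 + (ζ - 4 - 2) * (1 / 4 * Complex.log ((ζ - 4) / (4 * π))) +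
              t * (1 / 4 * Complex.log ((ζ - 4) / (4 * π))) ^ 2) -
            (-ζ / 4 + (ζ - 2) * (1 / 4 * Complex.log (ζ / (4 * π))) +
              t * (1 / 4 * Complex.log (ζ / (4 * π))) ^ 2))‖ ≤ Kg / ζ.im := by
  set Kw1 : ℝ := 1 / 4 * (1 + 2 * Real.log 3 + 2 * π) with hKw1
  have hlog3 : 0 ≤ Real.log 3 := Real.log_nonneg (by norm_num)
  have hKw10 : 0 < Kw1 := by simp only [hKw1]; positivity
  refine ⟨4 * π * Real.exp (5 + 4 * T₀ * Kw1), by positivity, ?_⟩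
  intro t ht ζ hre hζ2 hx
  set x : ℝ := ζ.im with hxdef
  have hπ : 0 < π := Real.pi_pos
  have hx1 : 1 ≤ x := by linarith only [hx, hπ]
  have hx0 : 0 < x := by linarith only [hx1]
  set w1 : ℂ := 1 / 4 * Complex.log (ζ / (4 * π)) with hw1
  set w2 : ℂ := 1 / 4 * Complex.log ((ζ - 4) / (4 * π)) with hw2
  have hζx : x ≤ ‖ζ‖ := by
    have := abs_im_le_norm ζ; rwa [← hxdef, abs_of_pos hx0] at this
  have hζ2x : x ≤ ‖ζ - 4‖ := by
    have h := abs_im_le_norm (ζ - 4)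
    have : (ζ - 4).im = x := by simp [hxdef]
    rwa [this, abs_of_pos hx0] at h
  have hζ2u : ‖ζ - 4‖ ≤ 3 * x := by
    calc ‖ζ - 4‖ ≤ ‖ζ‖ + ‖(4 : ℂ)‖ := norm_sub_le _ _
      _ ≤ 2 * x + 4 := by norm_num; linarith only [hζ2]
      _ ≤ 3 * x := by linarith only [hx, hπ]
  have hζ3 : ‖ζ‖ ≤ 3 * x := by linarith only [hζ2, hx0]
  have h4π1 : 4 * π ≤ ‖ζ‖ := by linarith only [hx, hζx]
  have h4π2 : 4 * π ≤ ‖ζ - 4‖ := by linarith only [hx, hζ2x]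
  have hL1 : 1 / 2 ≤ logPlus x := by
    have h := log_two_le_logPlus x
    have h2 : (1 / 2 : ℝ) ≤ Real.log 2 := by have := Real.log_two_gt_d9; linarith only [this]
    linarith only [h, h2]
  -- norms of `w1`, `w2`
  have hnw : ∀ w : ℂ, ‖w‖ ≤ 1 / 4 * (logPlus x + Real.log 3 + π) → ‖w‖ ≤ Kw1 * logPlus x := by
    intro w h1
    calc ‖w‖ ≤ 1 / 4 * (logPlus x + Real.log 3 + π) := h1
      _ ≤ 1 / 4 * (logPlus x + (2 * Real.log 3 + 2 * π) * logPlus x) := by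
          have h3 : Real.log 3 + π ≤ (2 * Real.log 3 + 2 * π) * logPlus x := by
            have e : Real.log 3 + π = (2 * Real.log 3 + 2 * π) * (1 / 2) := by ring
            rw [e]; exact mul_le_mul_of_nonneg_left hL1 (by positivity)
          linarith only [h3]
      _ = Kw1 * logPlus x := by simp only [hKw1]; ring
  have hnw1 : ‖w1‖ ≤ Kw1 * logPlus x := hnw w1 (norm_w1_le hx1 h4π1 hζ3)
  have hnw2 : ‖w2‖ ≤ Kw1 * logPlus x := by
    have hx2 : ‖ζ - 4‖ ≤ 3 * (ζ - 4).im := by simp [hxdef] at hζ2u ⊢; exact hζ2u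
    have := norm_w1_le (ζ := ζ - 4) (x := x) hx1 h4π2 hζ2u
    exact hnw w2 this
  -- `Δ = w2 − w1` is `O(1/x)`
  have hΔ : ‖w2 - w1‖ ≤ 1 / x := by
    have h4πc : (4 : ℂ) * π = ((4 * π : ℝ) : ℂ) := by push_cast; ring
    have hv : 0 < x / (4 * π) := by positivity
    have him1 : (ζ / (4 * π)).im = x / (4 * π) := by rw [h4πc, Complex.div_ofReal_im]
    have him2 : ((ζ - 4) / (4 * π)).im = x / (4 * π) := by
      rw [h4πc, Complex.div_ofReal_im]; simp [hxdef]
    have hre1 : 0 < (ζ / (4 * π)).re := by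
      rw [h4πc, Complex.div_ofReal_re]; exact div_pos (by linarith only [hre]) (by positivity)
    have hre2 : 0 < ((ζ - 4) / (4 * π)).re := by
      rw [h4πc, Complex.div_ofReal_re]
      exact div_pos (by simp; linarith only [hre]) (by positivity)
    have h := norm_log_sub_log_le hv him2 him1 hre2 hre1
    have hdiff : ‖(ζ - 4) / (4 * π) - ζ / (4 * π)‖ = 1 / π := by
      rw [← sub_div, show ζ - 4 - ζ = (-4 : ℂ) by ring, norm_div, h4πc, Complex.norm_real,
        Real.norm_of_nonneg (by positivity)]
      norm_num
      field_simp
    rw [hdiff] at h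
    have e : w2 - w1 = 1 / 4 * (Complex.log ((ζ - 4) / (4 * π)) - Complex.log (ζ / (4 * π))) := by
      simp only [hw1, hw2]; ring
    rw [e, norm_mul, show ‖(1 / 4 : ℂ)‖ = 1 / 4 by norm_num]
    calc 1 / 4 * ‖Complex.log ((ζ - 4) / (4 * π)) - Complex.log (ζ / (4 * π))‖
        ≤ 1 / 4 * (1 / (x / (4 * π)) * (1 / π)) := mul_le_mul_of_nonneg_left h (by norm_num)
      _ = 1 / x := by field_simp
  -- the identity `g₂ − g₁ = 1 − 4 w2 + (ζ − 2)(w2 − w1) + t (w2 − w1)(w2 + w1)`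
  have hid : (-(ζ - 4) / 4 + (ζ - 4 - 2) * w2 + t * w2 ^ 2) - (-ζ / 4 + (ζ - 2) * w1 + t * w1 ^ 2)
      = 1 - 4 * w2 + (ζ - 2) * (w2 - w1) + t * (w2 - w1) * (w2 + w1) := by ring
  rw [hid, Complex.norm_exp]
  -- real part bounds
  have hre_w2 : (4 * w2).re = Real.log (‖ζ - 4‖ / (4 * π)) := by
    have e : 4 * w2 = Complex.log ((ζ - 4) / (4 * π)) := by simp only [hw2]; ring
    rw [e, Complex.log_re, norm_div]
    congr 2
    rw [show (4 : ℂ) * π = ((4 * π : ℝ) : ℂ) by push_cast; ring, Complex.norm_real,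
      Real.norm_of_nonneg (by positivity)]
  have hT2 : ((ζ - 2) * (w2 - w1)).re ≤ 4 := by
    refine (Complex.re_le_norm _).trans ?_
    rw [norm_mul]
    have h1 : ‖ζ - 2‖ ≤ 4 * x := by
      calc ‖ζ - 2‖ ≤ ‖ζ‖ + ‖(2 : ℂ)‖ := norm_sub_le _ _
        _ ≤ 2 * x + 2 := by norm_num; linarith only [hζ2]
        _ ≤ 4 * x := by linarith only [hx1]
    calc ‖ζ - 2‖ * ‖w2 - w1‖ ≤ (4 * x) * (1 / x) :=
          mul_le_mul h1 hΔ (norm_nonneg _) (by positivity)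
      _ = 4 := by field_simp
  have habs : |t| ≤ T₀ := by rw [abs_of_nonpos ht.2]; linarith only [ht.1]
  have hLx2 : logPlus x / x ≤ 2 := by
    rw [div_le_iff₀ hx0, logPlus_of_nonneg hx0.le]
    have := Real.log_le_sub_one_of_pos (show 0 < 2 + x by linarith only [hx0])
    linarith only [this, hx1]
  have hT3 : ((t : ℂ) * (w2 - w1) * (w2 + w1)).re ≤ 4 * T₀ * Kw1 := by
    refine (Complex.re_le_norm _).trans ?_
    rw [norm_mul, norm_mul, Complex.norm_real, Real.norm_eq_abs]
    have h1 : ‖w2 + w1‖ ≤ 2 * Kw1 * logPlus x := by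
      calc ‖w2 + w1‖ ≤ ‖w2‖ + ‖w1‖ := norm_add_le _ _
        _ ≤ 2 * Kw1 * logPlus x := by linarith only [hnw1, hnw2]
    have h2 : |t| * ‖w2 - w1‖ ≤ T₀ * (1 / x) := mul_le_mul habs hΔ (norm_nonneg _) hT₀
    calc |t| * ‖w2 - w1‖ * ‖w2 + w1‖ ≤ T₀ * (1 / x) * (2 * Kw1 * logPlus x) :=
          mul_le_mul h2 h1 (norm_nonneg _) (by positivity)
      _ = 2 * T₀ * Kw1 * (logPlus x / x) := by ring
      _ ≤ 2 * T₀ * Kw1 * 2 := mul_le_mul_of_nonneg_left hLx2 (by positivity)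
      _ = 4 * T₀ * Kw1 := by ring
  have hre_tot : (1 - 4 * w2 + (ζ - 2) * (w2 - w1) + (t : ℂ) * (w2 - w1) * (w2 + w1)).re ≤
      5 + 4 * T₀ * Kw1 - Real.log (‖ζ - 4‖ / (4 * π)) := by
    have e : (1 - 4 * w2 + (ζ - 2) * (w2 - w1) + (t : ℂ) * (w2 - w1) * (w2 + w1)).re =
        1 - (4 * w2).re + ((ζ - 2) * (w2 - w1)).re + ((t : ℂ) * (w2 - w1) * (w2 + w1)).re := by
      simp only [Complex.add_re, Complex.sub_re, Complex.one_re]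
    rw [e, hre_w2]; linarith only [hT2, hT3]
  have hq : 0 < ‖ζ - 4‖ / (4 * π) := div_pos (lt_of_lt_of_le hx0 hζ2x) (by positivity)
  calc Real.exp (1 - 4 * w2 + (ζ - 2) * (w2 - w1) + (t : ℂ) * (w2 - w1) * (w2 + w1)).re
      ≤ Real.exp (5 + 4 * T₀ * Kw1 - Real.log (‖ζ - 4‖ / (4 * π))) := Real.exp_le_exp.2 hre_tot
    _ = Real.exp (5 + 4 * T₀ * Kw1) * (4 * π / ‖ζ - 4‖) := by
        rw [Real.exp_sub, Real.exp_log hq]; field_simp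
    _ ≤ Real.exp (5 + 4 * T₀ * Kw1) * (4 * π / x) := by
        refine mul_le_mul_of_nonneg_left ?_ (Real.exp_pos _).le
        exact div_le_div_of_nonneg_left (by positivity) hx0 hζ2x
    _ = 4 * π * Real.exp (5 + 4 * T₀ * Kw1) / x := by ring

/-! ## §6 Bookkeeping: from the two `I_t`-asymptotics and the p.19 estimate to `H_t = π² c₀ e^{g}(1 + O(log₊² x/x))` -/

/-- **Main-term bookkeeping** (FMP p. 19: "Inserting these bounds into (18) …"): if
`Q = 2π² I₁ − 3π I₂`, `‖I_i − c e_i‖ ≤ K E ‖e_i‖`, `‖e₂‖ ≤ (K_g/x) ‖e₁‖`, `‖H − Q/2‖ ≤ A E ‖Q‖`,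
`1/x ≤ 4E`, `E ≤ 1`, then `‖H − π² c e₁‖ ≤ K_ω E ‖e₁‖` with
`K_ω = A(2π²c + K_Q) + K_Q/2`, `K_Q = 2π²K + 12πK K_g + 12π c K_g`. [cite: RodgersTaoFMP2020, §2 p. 19 (FMP)] -/
theorem main_term_bookkeeping {H Q I₁ I₂ e₁ e₂ : ℂ} {c K Kg A E x : ℝ} (hc : 0 ≤ c) (hK : 0 ≤ K)
    (hKg : 0 ≤ Kg) (hA : 0 ≤ A) (hE : 0 ≤ E) (hxE : 1 / x ≤ 4 * E) (hE1 : E ≤ 1)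
    (hQ : Q = 2 * π ^ 2 * I₁ - 3 * π * I₂)
    (h1 : ‖I₁ - c * e₁‖ ≤ K * E * ‖e₁‖) (h2 : ‖I₂ - c * e₂‖ ≤ K * E * ‖e₂‖)
    (hg : ‖e₂‖ ≤ Kg / x * ‖e₁‖) (hH : ‖H - Q / 2‖ ≤ A * E * ‖Q‖) :
    ‖H - (π ^ 2 * c : ℝ) * e₁‖ ≤
      (A * (2 * π ^ 2 * c + (2 * π ^ 2 * K + 12 * π * K * Kg + 12 * π * c * Kg)) +
        (2 * π ^ 2 * K + 12 * π * K * Kg + 12 * π * c * Kg) / 2) * E * ‖e₁‖ := by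
  have hπ : 0 < π := Real.pi_pos
  set KQ : ℝ := 2 * π ^ 2 * K + 12 * π * K * Kg + 12 * π * c * Kg with hKQ
  have he1 : 0 ≤ ‖e₁‖ := norm_nonneg _
  have hKgx : Kg / x ≤ 4 * Kg * E := by
    have : Kg / x = Kg * (1 / x) := by ring
    rw [this]; nlinarith only [hxE, hKg]
  -- `‖Q − 2π² c e₁‖ ≤ KQ E ‖e₁‖`
  have hQm : ‖Q - 2 * π ^ 2 * c * e₁‖ ≤ KQ * E * ‖e₁‖ := by
    have e : Q - 2 * π ^ 2 * c * e₁ =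
        2 * π ^ 2 * (I₁ - c * e₁) - 3 * π * (I₂ - c * e₂) - 3 * π * c * e₂ := by
      rw [hQ]; ring
    rw [e]
    have n1 : ‖2 * (π : ℂ) ^ 2 * (I₁ - c * e₁)‖ ≤ 2 * π ^ 2 * (K * E * ‖e₁‖) := by
      rw [norm_mul, show ‖2 * (π : ℂ) ^ 2‖ = 2 * π ^ 2 by
        rw [norm_mul, norm_pow, Complex.norm_real, Real.norm_of_nonneg hπ.le]; norm_num]
      exact mul_le_mul_of_nonneg_left h1 (by positivity)
    have n2 : ‖3 * (π : ℂ) * (I₂ - c * e₂)‖ ≤ 3 * π * (K * E * (Kg / x * ‖e₁‖)) := by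
      rw [norm_mul, show ‖3 * (π : ℂ)‖ = 3 * π by
        rw [norm_mul, Complex.norm_real, Real.norm_of_nonneg hπ.le]; norm_num]
      refine mul_le_mul_of_nonneg_left (h2.trans ?_) (by positivity)
      exact mul_le_mul_of_nonneg_left hg (by positivity)
    have n3 : ‖3 * (π : ℂ) * c * e₂‖ ≤ 3 * π * c * (Kg / x * ‖e₁‖) := by
      rw [norm_mul, show ‖3 * (π : ℂ) * c‖ = 3 * π * c by
        rw [norm_mul, norm_mul, Complex.norm_real, Complex.norm_real, Real.norm_of_nonneg hπ.le,
          Real.norm_of_nonneg hc]; norm_num]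
      exact mul_le_mul_of_nonneg_left hg (by positivity)
    have hs : ‖2 * (π : ℂ) ^ 2 * (I₁ - c * e₁) - 3 * π * (I₂ - c * e₂) - 3 * π * c * e₂‖ ≤
        2 * π ^ 2 * (K * E * ‖e₁‖) + 3 * π * (K * E * (Kg / x * ‖e₁‖)) +
          3 * π * c * (Kg / x * ‖e₁‖) := by
      have a1 := norm_sub_le (2 * (π : ℂ) ^ 2 * (I₁ - c * e₁) - 3 * π * (I₂ - c * e₂))
        (3 * π * c * e₂)
      have a2 := norm_sub_le (2 * (π : ℂ) ^ 2 * (I₁ - c * e₁)) (3 * π * (I₂ - c * e₂))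
      linarith only [a1, a2, n1, n2, n3]
    refine hs.trans ?_
    have b1 : 3 * π * (K * E * (Kg / x * ‖e₁‖)) ≤ 3 * π * (K * E * (4 * Kg * ‖e₁‖)) := by
      have h3 : Kg / x * ‖e₁‖ ≤ 4 * Kg * ‖e₁‖ := by
        have h4 : Kg / x ≤ 4 * Kg := hKgx.trans (by nlinarith only [hE1, hKg])
        exact mul_le_mul_of_nonneg_right h4 he1
      have hKE : 0 ≤ K * E := by positivity
      have h5 : K * E * (Kg / x * ‖e₁‖) ≤ K * E * (4 * Kg * ‖e₁‖) :=
        mul_le_mul_of_nonneg_left h3 hKE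
      exact mul_le_mul_of_nonneg_left h5 (by positivity)
    have b2 : 3 * π * c * (Kg / x * ‖e₁‖) ≤ 3 * π * c * (4 * Kg * E * ‖e₁‖) := by
      have : Kg / x * ‖e₁‖ ≤ 4 * Kg * E * ‖e₁‖ := mul_le_mul_of_nonneg_right hKgx he1
      exact mul_le_mul_of_nonneg_left this (by positivity)
    have e2 : KQ * E * ‖e₁‖ = 2 * π ^ 2 * (K * E * ‖e₁‖) + 3 * π * (K * E * (4 * Kg * ‖e₁‖)) +
        3 * π * c * (4 * Kg * E * ‖e₁‖) := by simp only [hKQ]; ring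
    rw [e2]; linarith only [b1, b2]
  -- `‖Q‖ ≤ (2π²c + KQ) ‖e₁‖`
  have hQn : ‖Q‖ ≤ (2 * π ^ 2 * c + KQ) * ‖e₁‖ := by
    have a1 : ‖Q‖ ≤ ‖Q - 2 * π ^ 2 * c * e₁‖ + ‖2 * (π : ℂ) ^ 2 * c * e₁‖ := by
      have := norm_add_le (Q - 2 * π ^ 2 * c * e₁) (2 * (π : ℂ) ^ 2 * c * e₁)
      rwa [sub_add_cancel] at this
    have a2 : ‖2 * (π : ℂ) ^ 2 * c * e₁‖ = 2 * π ^ 2 * c * ‖e₁‖ := by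
      rw [norm_mul, norm_mul, norm_mul, norm_pow, Complex.norm_real, Complex.norm_real,
        Real.norm_of_nonneg hπ.le, Real.norm_of_nonneg hc]; norm_num
    have a3 : KQ * E * ‖e₁‖ ≤ KQ * ‖e₁‖ := by
      have hKQ0 : 0 ≤ KQ := by simp only [hKQ]; positivity
      have := mul_le_mul_of_nonneg_left hE1 hKQ0
      nlinarith only [this, he1]
    calc ‖Q‖ ≤ ‖Q - 2 * π ^ 2 * c * e₁‖ + ‖2 * (π : ℂ) ^ 2 * c * e₁‖ := a1
      _ = ‖Q - 2 * π ^ 2 * c * e₁‖ + 2 * π ^ 2 * c * ‖e₁‖ := by rw [a2]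
      _ ≤ KQ * E * ‖e₁‖ + 2 * π ^ 2 * c * ‖e₁‖ := by linarith only [hQm]
      _ ≤ (2 * π ^ 2 * c + KQ) * ‖e₁‖ := by linarith only [a3]
  -- conclusion
  have hfin : ‖H - (π ^ 2 * c : ℝ) * e₁‖ ≤ ‖H - Q / 2‖ + ‖Q - 2 * π ^ 2 * c * e₁‖ / 2 := by
    have e : H - (π ^ 2 * c : ℝ) * e₁ = (H - Q / 2) + (Q - 2 * π ^ 2 * c * e₁) / 2 := by
      push_cast; ring
    rw [e]
    refine (norm_add_le _ _).trans ?_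
    rw [norm_div, show ‖(2 : ℂ)‖ = 2 by norm_num]
  calc ‖H - (π ^ 2 * c : ℝ) * e₁‖ ≤ ‖H - Q / 2‖ + ‖Q - 2 * π ^ 2 * c * e₁‖ / 2 := hfin
    _ ≤ A * E * ((2 * π ^ 2 * c + KQ) * ‖e₁‖) + KQ * E * ‖e₁‖ / 2 := by
        have := hH.trans (mul_le_mul_of_nonneg_left hQn (by positivity))
        linarith only [this, hQm]
    _ = (A * (2 * π ^ 2 * c + KQ) + KQ / 2) * E * ‖e₁‖ := by ring

/-! ## §7 Disc geometry: `log₊` is essentially constant on discs of radius `log₊ x / 2` -/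

/-- `log₊ x ≤ x` for `x ≥ 2`. [folklore] -/
private theorem logPlus_le_self {x : ℝ} (hx : 2 ≤ x) : logPlus x ≤ x := by
  rw [logPlus_of_nonneg (by linarith), Real.log_le_iff_le_exp (by linarith)]
  have := Real.quadratic_le_exp_of_nonneg (show (0 : ℝ) ≤ x by linarith)
  nlinarith

/-- `log₊` comparisons between `x ≥ 2` and `x'` with `|x' − x| ≤ log₊ x / 2`:
`x/2 ≤ x'`, `log₊ x' ≤ 2 log₊ x`, `log₊ x ≤ 2 log₊ x'`. [folklore] -/
private theorem logPlus_near {x x' : ℝ} (hx : 2 ≤ x) (h : |x' - x| ≤ logPlus x / 2) :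
    x / 2 ≤ x' ∧ logPlus x' ≤ 2 * logPlus x ∧ logPlus x ≤ 2 * logPlus x' := by
  have hL := logPlus_le_self hx
  obtain ⟨h1, h2⟩ := abs_le.1 h
  have hx'l : x / 2 ≤ x' := by linarith
  have hx'0 : 0 ≤ x' := by linarith
  refine ⟨hx'l, ?_, ?_⟩
  · rw [logPlus_of_nonneg hx'0, logPlus_of_nonneg (by linarith)]
    have e : 2 * Real.log (2 + x) = Real.log ((2 + x) ^ 2) := by
      rw [Real.log_pow]; norm_num
    rw [e]
    exact Real.log_le_log (by linarith) (by nlinarith)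
  · rw [logPlus_of_nonneg hx'0, logPlus_of_nonneg (by linarith)]
    have e : 2 * Real.log (2 + x') = Real.log ((2 + x') ^ 2) := by
      rw [Real.log_pow]; norm_num
    rw [e]
    exact Real.log_le_log (by linarith) (by nlinarith)

/-- A point `w` of the disc `|w − (x − iκ log₊ x)| < log₊ x / 2` is `x' − i y'` with `x' = Re w ≥ x/2`,
`y' = −Im w = κ' log₊ x'`, `(κ − 1/2)/2 ≤ κ' ≤ 2κ + 1`, and `w = rodgersTaoZ x' κ'`;
moreover `log₊² x'/x' ≤ 8 log₊² x / x`. [folklore] -/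
private theorem disc_point {x κ : ℝ} (hx : 2 ≤ x) (hκ : 1 / 2 ≤ κ) {w : ℂ}
    (hw : w ∈ Metric.ball (rodgersTaoZ x κ) (logPlus x / 2)) :
    x / 2 ≤ w.re ∧
      (κ - 1 / 2) / 2 ≤ -w.im / logPlus w.re ∧ -w.im / logPlus w.re ≤ 2 * κ + 1 ∧
      rodgersTaoZ w.re (-w.im / logPlus w.re) = w ∧
      logPlus w.re ^ 2 / w.re ≤ 8 * (logPlus x ^ 2 / x) := by
  have hd : ‖w - rodgersTaoZ x κ‖ < logPlus x / 2 := by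
    rw [← dist_eq_norm]; exact Metric.mem_ball.1 hw
  have hre : |w.re - x| ≤ logPlus x / 2 := by
    have h := abs_re_le_norm (w - rodgersTaoZ x κ)
    have e : (w - rodgersTaoZ x κ).re = w.re - x := by simp [rodgersTaoZ]
    rw [e] at h; linarith
  have him : |w.im + κ * logPlus x| ≤ logPlus x / 2 := by
    have h := abs_im_le_norm (w - rodgersTaoZ x κ)
    have e : (w - rodgersTaoZ x κ).im = w.im + κ * logPlus x := by simp [rodgersTaoZ]
    rw [e] at h; linarith
  obtain ⟨hx', hL1, hL2⟩ := logPlus_near hx hre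
  have hLpos : 0 < logPlus w.re := logPlus_pos _
  have hLx : 0 < logPlus x := logPlus_pos _
  obtain ⟨hi1, hi2⟩ := abs_le.1 him
  refine ⟨hx', ?_, ?_, ?_, ?_⟩
  · rw [le_div_iff₀ hLpos]
    have : (κ - 1 / 2) / 2 * logPlus w.re ≤ (κ - 1 / 2) * logPlus x := by
      have h0 : 0 ≤ κ - 1 / 2 := by linarith
      calc (κ - 1 / 2) / 2 * logPlus w.re = (κ - 1 / 2) * (logPlus w.re / 2) := by ring
        _ ≤ (κ - 1 / 2) * logPlus x := mul_le_mul_of_nonneg_left (by linarith) h0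
    linarith
  · rw [div_le_iff₀ hLpos]
    have : (κ + 1 / 2) * logPlus x ≤ (2 * κ + 1) * logPlus w.re := by
      have h0 : 0 ≤ κ + 1 / 2 := by linarith
      calc (κ + 1 / 2) * logPlus x ≤ (κ + 1 / 2) * (2 * logPlus w.re) :=
            mul_le_mul_of_nonneg_left hL2 h0
        _ = (2 * κ + 1) * logPlus w.re := by ring
    linarith
  · apply Complex.ext
    · simp [rodgersTaoZ]
    · simp [rodgersTaoZ]
      field_simp
  · have hx0 : 0 < x := by linarith
    have hx'0 : 0 < w.re := by linarith
    rw [div_le_iff₀ hx'0]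
    have h1 : logPlus w.re ^ 2 ≤ 4 * logPlus x ^ 2 := by nlinarith [logPlus_nonneg w.re]
    have h2 : 4 * logPlus x ^ 2 ≤ 8 * (logPlus x ^ 2 / x) * w.re := by
      rw [show 8 * (logPlus x ^ 2 / x) * w.re = 4 * logPlus x ^ 2 * (2 * w.re / x) by
        field_simp; ring]
      have : 1 ≤ 2 * w.re / x := by rw [le_div_iff₀ hx0]; linarith
      nlinarith [sq_nonneg (logPlus x)]
    linarith

/-! ## §8 The explicit phase along `ζ = 9 + i z` and its derivative -/

/-- Derivative of `z ↦ g_t(9 + iz)`, `g_t(ζ) = −ζ/4 + (ζ − 2)·¼Log(ζ/4π) + t(¼Log(ζ/4π))²`: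
`g' = (i/4)Log(ζ/4π) − i/(2ζ) + (it/8)Log(ζ/4π)/ζ` (valid where `Re ζ > 0`). [folklore] -/
private theorem hasDerivAt_phase (t : ℝ) {z : ℂ} (hz : 0 < (9 + I * z).re) :
    HasDerivAt (fun z : ℂ ↦ -(9 + I * z) / 4 +
        (9 + I * z - 2) * (1 / 4 * Complex.log ((9 + I * z) / (4 * π))) +
        t * (1 / 4 * Complex.log ((9 + I * z) / (4 * π))) ^ 2)
      (I / 4 * Complex.log ((9 + I * z) / (4 * π)) - I / (2 * (9 + I * z)) +
        I * t / 8 * Complex.log ((9 + I * z) / (4 * π)) / (9 + I * z)) z := by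
  have hπ : 0 < π := Real.pi_pos
  have h4π : (4 : ℂ) * π ≠ 0 := mul_ne_zero (by norm_num) (by exact_mod_cast hπ.ne')
  set ζ : ℂ := 9 + I * z with hζ
  have hζ0 : ζ ≠ 0 := fun h ↦ by rw [h] at hz; simp at hz
  have hζ' : HasDerivAt (fun z : ℂ ↦ 9 + I * z) I z := by
    simpa using ((hasDerivAt_id z).const_mul I).const_add 9
  have hq : HasDerivAt (fun z : ℂ ↦ (9 + I * z) / (4 * π)) (I / (4 * π)) z :=
    hζ'.div_const _
  have hslit : (9 + I * z) / (4 * π) ∈ Complex.slitPlane := by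
    refine Complex.mem_slitPlane_iff.2 (Or.inl ?_)
    rw [show (4 : ℂ) * π = ((4 * π : ℝ) : ℂ) by push_cast; ring, Complex.div_ofReal_re]
    exact div_pos hz (by positivity)
  have hlog : HasDerivAt (fun z : ℂ ↦ Complex.log ((9 + I * z) / (4 * π))) (I / ζ) z := by
    have h := hq.clog hslit
    have e : I / (4 * π) / ((9 + I * z) / (4 * π)) = I / ζ := by
      rw [hζ]; field_simp
    rwa [e] at h
  have hw1 : HasDerivAt (fun z : ℂ ↦ 1 / 4 * Complex.log ((9 + I * z) / (4 * π)))
      (1 / 4 * (I / ζ)) z := hlog.const_mul _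
  have hA : HasDerivAt (fun z : ℂ ↦ -(9 + I * z) / 4) (-I / 4) z := by
    have := (hζ'.neg).div_const 4
    simpa [neg_div] using this
  have hB : HasDerivAt (fun z : ℂ ↦ (9 + I * z - 2) * (1 / 4 * Complex.log ((9 + I * z) / (4 * π))))
      (I * (1 / 4 * Complex.log ((9 + I * z) / (4 * π))) + (9 + I * z - 2) * (1 / 4 * (I / ζ))) z := by
    have h1 : HasDerivAt (fun z : ℂ ↦ 9 + I * z - 2) I z := by
      simpa using hζ'.sub_const 2
    exact h1.mul hw1
  have hC : HasDerivAt (fun z : ℂ ↦ (t : ℂ) * (1 / 4 * Complex.log ((9 + I * z) / (4 * π))) ^ 2)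
      ((t : ℂ) * (2 * (1 / 4 * Complex.log ((9 + I * z) / (4 * π))) * (1 / 4 * (I / ζ)))) z := by
    have h1 := hw1.pow 2
    have h2 := h1.const_mul (t : ℂ)
    simpa [pow_one] using h2
  have hsum : HasDerivAt (fun z : ℂ ↦ -(9 + I * z) / 4 +
        (9 + I * z - 2) * (1 / 4 * Complex.log ((9 + I * z) / (4 * π))) +
        t * (1 / 4 * Complex.log ((9 + I * z) / (4 * π))) ^ 2)
      (-I / 4 + (I * (1 / 4 * Complex.log ((9 + I * z) / (4 * π))) +
        (9 + I * z - 2) * (1 / 4 * (I / ζ))) +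
        (t : ℂ) * (2 * (1 / 4 * Complex.log ((9 + I * z) / (4 * π))) * (1 / 4 * (I / ζ)))) z :=
    (hA.add hB).add hC
  refine hsum.congr_deriv ?_
  have hζ0' : (9 : ℂ) + I * z ≠ 0 := by rw [← hζ]; exact hζ0
  rw [hζ]
  field_simp
  ring

/-- The derivative of the explicit phase at `z = x − iκ log₊ x` is `(i/4) Log(iz/4π) + O(log₊ x/x)`:
precisely, with `ζ = 9 + iz`, `‖g'(z) − (i/4)Log(iz/4π)‖ ≤ (4 + T₀(log₊ x + log 3 + π)/8)/x`
for `x ≥ 4π + 1`, `0 < κ log₊ x`, `‖ζ‖ ≤ 3x`, `|t| ≤ T₀`. [folklore] -/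
private theorem phase_deriv_near {T₀ t x κ : ℝ} (ht : |t| ≤ T₀) (hx : 4 * π + 1 ≤ x)
    (hy : 0 < κ * logPlus x) (hζ3 : ‖9 + I * rodgersTaoZ x κ‖ ≤ 3 * x) :
    ‖(I / 4 * Complex.log ((9 + I * rodgersTaoZ x κ) / (4 * π)) - I / (2 * (9 + I * rodgersTaoZ x κ)) +
        I * t / 8 * Complex.log ((9 + I * rodgersTaoZ x κ) / (4 * π)) / (9 + I * rodgersTaoZ x κ)) -
      I / 4 * Complex.log (I * rodgersTaoZ x κ / (4 * π))‖ ≤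
      (4 + T₀ * (logPlus x + Real.log 3 + π) / 8) / x := by
  have hπ : 0 < π := Real.pi_pos
  have hx1 : 1 ≤ x := by linarith
  have hx0 : 0 < x := by linarith
  set z : ℂ := rodgersTaoZ x κ with hz
  set ζ : ℂ := 9 + I * z with hζ
  have hIz_re : (I * z).re = κ * logPlus x := by simp [hz, rodgersTaoZ]
  have hIz_im : (I * z).im = x := by simp [hz, rodgersTaoZ]
  have hζre : ζ.re = 9 + κ * logPlus x := by simp [hζ, hIz_re]
  have hζim : ζ.im = x := by simp [hζ, hIz_im]
  have hζx : x ≤ ‖ζ‖ := by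
    have := abs_im_le_norm ζ; rwa [hζim, abs_of_pos hx0] at this
  have hζ0 : ζ ≠ 0 := by
    intro h; rw [h] at hζx; simp at hζx; linarith
  have h4πc : (4 : ℂ) * π = ((4 * π : ℝ) : ℂ) := by push_cast; ring
  -- the log comparison along the horizontal line `Im = x/(4π)`
  have hlogdiff : ‖Complex.log (ζ / (4 * π)) - Complex.log (I * z / (4 * π))‖ ≤ 9 / x := by
    have hv : 0 < x / (4 * π) := by positivity
    have him1 : (ζ / (4 * π)).im = x / (4 * π) := by rw [h4πc, Complex.div_ofReal_im, hζim]
    have him2 : (I * z / (4 * π)).im = x / (4 * π) := by rw [h4πc, Complex.div_ofReal_im, hIz_im]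
    have hre1 : 0 < (ζ / (4 * π)).re := by
      rw [h4πc, Complex.div_ofReal_re, hζre]; exact div_pos (by linarith) (by positivity)
    have hre2 : 0 < (I * z / (4 * π)).re := by
      rw [h4πc, Complex.div_ofReal_re, hIz_re]; exact div_pos hy (by positivity)
    have h := norm_log_sub_log_le hv him1 him2 hre1 hre2
    have hd : ‖ζ / (4 * π) - I * z / (4 * π)‖ = 9 / (4 * π) := by
      rw [← sub_div, show ζ - I * z = (9 : ℂ) by simp [hζ], norm_div, h4πc, Complex.norm_real,
        Real.norm_of_nonneg (by positivity)]
      norm_num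
    rw [hd] at h
    calc _ ≤ 1 / (x / (4 * π)) * (9 / (4 * π)) := h
      _ = 9 / x := by field_simp
  -- the norm of `Log(ζ/4π)`
  have hlog_le : ‖Complex.log (ζ / (4 * π))‖ ≤ logPlus x + Real.log 3 + π := by
    have h := norm_w1_le hx1 (by linarith) hζ3
    rw [norm_mul, show ‖(1 / 4 : ℂ)‖ = 1 / 4 by norm_num] at h
    linarith
  -- assemble
  have e : (I / 4 * Complex.log (ζ / (4 * π)) - I / (2 * ζ) +
        I * t / 8 * Complex.log (ζ / (4 * π)) / ζ) - I / 4 * Complex.log (I * z / (4 * π)) =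
      I / 4 * (Complex.log (ζ / (4 * π)) - Complex.log (I * z / (4 * π))) - I / (2 * ζ) +
        I * t / 8 * Complex.log (ζ / (4 * π)) / ζ := by ring
  rw [e]
  have n1 : ‖I / 4 * (Complex.log (ζ / (4 * π)) - Complex.log (I * z / (4 * π)))‖ ≤ 1 / 4 * (9 / x) := by
    rw [norm_mul, show ‖I / 4‖ = 1 / 4 by simp]
    exact mul_le_mul_of_nonneg_left hlogdiff (by norm_num)
  have n2 : ‖I / (2 * ζ)‖ ≤ 1 / (2 * x) := by
    rw [norm_div, Complex.norm_I, norm_mul, show ‖(2 : ℂ)‖ = 2 by norm_num]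
    exact div_le_div_of_nonneg_left (by norm_num) (by positivity) (by linarith)
  have n3 : ‖I * t / 8 * Complex.log (ζ / (4 * π)) / ζ‖ ≤ T₀ * (logPlus x + Real.log 3 + π) / 8 / x := by
    rw [norm_div, norm_mul, show ‖I * t / 8‖ = |t| / 8 by simp [Complex.norm_real, Real.norm_eq_abs]]
    rw [div_le_div_iff₀ (norm_pos_iff.2 hζ0) hx0]
    have hT₀ : 0 ≤ T₀ := (abs_nonneg t).trans ht
    have hl3 : 0 ≤ Real.log 3 := Real.log_nonneg (by norm_num)
    have hL0 : 0 ≤ logPlus x := logPlus_nonneg x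
    have h1 : |t| / 8 * ‖Complex.log (ζ / (4 * π))‖ ≤ T₀ / 8 * (logPlus x + Real.log 3 + π) :=
      mul_le_mul (by linarith) hlog_le (norm_nonneg _) (by positivity)
    have h2 : 0 ≤ T₀ / 8 * (logPlus x + Real.log 3 + π) := by positivity
    calc |t| / 8 * ‖Complex.log (ζ / (4 * π))‖ * x ≤ T₀ / 8 * (logPlus x + Real.log 3 + π) * x :=
          mul_le_mul_of_nonneg_right h1 hx0.le
      _ ≤ T₀ / 8 * (logPlus x + Real.log 3 + π) * ‖ζ‖ := mul_le_mul_of_nonneg_left hζx h2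
      _ = T₀ * (logPlus x + Real.log 3 + π) / 8 * ‖ζ‖ := by ring
  calc ‖I / 4 * (Complex.log (ζ / (4 * π)) - Complex.log (I * z / (4 * π))) - I / (2 * ζ) +
        I * t / 8 * Complex.log (ζ / (4 * π)) / ζ‖
      ≤ ‖I / 4 * (Complex.log (ζ / (4 * π)) - Complex.log (I * z / (4 * π)))‖ + ‖I / (2 * ζ)‖ +
          ‖I * t / 8 * Complex.log (ζ / (4 * π)) / ζ‖ := by
        have a1 := norm_add_le (I / 4 * (Complex.log (ζ / (4 * π)) - Complex.log (I * z / (4 * π))) -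
          I / (2 * ζ)) (I * t / 8 * Complex.log (ζ / (4 * π)) / ζ)
        have a2 := norm_sub_le (I / 4 * (Complex.log (ζ / (4 * π)) - Complex.log (I * z / (4 * π))))
          (I / (2 * ζ))
        linarith
    _ ≤ 1 / 4 * (9 / x) + 1 / (2 * x) + T₀ * (logPlus x + Real.log 3 + π) / 8 / x := by
        linarith [n1, n2, n3]
    _ ≤ (4 + T₀ * (logPlus x + Real.log 3 + π) / 8) / x := by
        have h1 : 1 / 4 * (9 / x) + 1 / (2 * x) ≤ 4 / x := by
          rw [show 1 / 4 * (9 / x) + 1 / (2 * x) = (11 / 4) / x by field_simp; ring]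
          exact div_le_div_of_nonneg_right (by norm_num) hx0.le
        have e2 : (4 + T₀ * (logPlus x + Real.log 3 + π) / 8) / x =
            4 / x + T₀ * (logPlus x + Real.log 3 + π) / 8 / x := by ring
        rw [e2]; linarith

/-! ## §9 The pointwise main term: `H_t(x − iκ log₊ x) = π² c₀ e^{g_t(ζ₁)} (1 + O(log₊² x / x))` -/

set_option maxHeartbeats 400000 in
/-- **Pointwise main-term estimate** (FMP p. 19 with the `n = 1` main terms made explicit): given
the p. 19 estimate `H_t = ½ Q_{t,1}(1 + O(log₊² x/x))` (hypothesis schema `hQ''`), the stationary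
phase asymptotic (31) at `b = π` (schema `hI''`), existence of strip saddle points (schema `hE''`,
Lemma 2.3), the saddle-point perturbation bounds (`hsad`, from `saddle_perturbation`) and the
two-term comparison (`hgsub`, from `norm_cexp_phase_sub_le`), uniformly for `−T ≤ t < 0`,
`x ≥ X`, `C'_l ≤ κ ≤ C_h`:
`‖H_t(x − iκ log₊ x) − π² c₀ e^{g_t(ζ₁)}‖ ≤ K_ω (log₊² x/x) ‖e^{g_t(ζ₁)}‖`, `ζ₁ = 9 + κ log₊ x + ix`,
`g_t(ζ) = −ζ/4 + (ζ − 2)·¼Log(ζ/4π) + t(¼Log(ζ/4π))²`, `c₀ = √(π/8) e^{−½ log π}`.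
[cite: RodgersTaoFMP2020, §2 p. 19 (FMP)] -/
theorem pointwise_estimate {T : ℝ} {C'l Ch C''Q AQ C''I AI C''E Xs Ks Kg : ℝ}
    (hC'l : 0 < C'l) (hCh : 0 ≤ Ch) (hAQ : 0 < AQ) (hAI : 0 < AI) (hKs : 0 < Ks) (hKg : 0 < Kg)
    (hQ'' : ∀ t ∈ Ico (-T) 0, ∀ x : ℝ, C''Q ≤ x → ∀ κ ∈ Icc C'l Ch,
      ‖deBruijnH t (rodgersTaoZ x κ) - rodgersTaoQ t 1 x (κ * logPlus x) / 2‖ ≤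
        AQ * (logPlus x ^ 2 / x) * ‖rodgersTaoQ t 1 x (κ * logPlus x)‖)
    (hI'' : ∀ t ∈ Ico (-T) 0, ∀ ζ ∈ rodgersTaoOmega (Ch + 10) C'l C''I, ∀ w₀ ∈ rodgersTaoStrip,
      rodgersTaoSaddleEq t π ζ w₀ →
        ‖rodgersTaoI t π ζ -
            (Real.sqrt (π / 8) : ℂ) * cexp (t * w₀ ^ 2 - π * cexp (4 * w₀) + ζ * w₀) *
              ((π : ℂ) * cexp (4 * w₀)) ^ (-(1 / 2 : ℂ))‖ ≤
          AI * ‖cexp (t * w₀ ^ 2 - π * cexp (4 * w₀) + ζ * w₀)‖ /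
            ‖(π : ℂ) * cexp (4 * w₀)‖ ^ (3 / 2 : ℝ))
    (hE'' : ∀ t ∈ Icc (-T) 0, ∀ ζ ∈ rodgersTaoOmega (Ch + 10) C'l C''E,
      ∃ w₀ ∈ rodgersTaoStrip, rodgersTaoSaddleEq t π ζ w₀)
    (hsad : ∀ t ∈ Icc (-T) 0, ∀ ζ w : ℂ, 0 < ζ.re → ‖ζ‖ ≤ 3 * ζ.im → Xs ≤ ζ.im →
      w ∈ rodgersTaoStrip → rodgersTaoSaddleEq t π ζ w →
        ζ.im / 8 ≤ ‖(π : ℂ) * cexp (4 * w)‖ ∧ ‖w‖ ≤ Ks * logPlus ζ.im ∧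
        ‖w - 1 / 4 * Complex.log (ζ / (4 * π))‖ ≤ Ks * logPlus ζ.im / ζ.im ∧
        ‖(t * w ^ 2 - π * cexp (4 * w) + ζ * w - 2 * w) -
            (-ζ / 4 + (ζ - 2) * (1 / 4 * Complex.log (ζ / (4 * π))) +
              t * (1 / 4 * Complex.log (ζ / (4 * π))) ^ 2)‖ ≤ Ks * logPlus ζ.im ^ 2 / ζ.im)
    (hgsub : ∀ t ∈ Icc (-T) 0, ∀ ζ : ℂ, 4 < ζ.re → ‖ζ‖ ≤ 2 * ζ.im → 4 * π + 4 ≤ ζ.im →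
      ‖cexp ((-(ζ - 4) / 4 + (ζ - 4 - 2) * (1 / 4 * Complex.log ((ζ - 4) / (4 * π))) +
              t * (1 / 4 * Complex.log ((ζ - 4) / (4 * π))) ^ 2) -
            (-ζ / 4 + (ζ - 2) * (1 / 4 * Complex.log (ζ / (4 * π))) +
              t * (1 / 4 * Complex.log (ζ / (4 * π))) ^ 2))‖ ≤ Kg / ζ.im) :
    ∃ X Kω : ℝ, 0 < X ∧ 0 < Kω ∧ ∀ t ∈ Ico (-T) 0, ∀ x : ℝ, X ≤ x → ∀ κ ∈ Icc C'l Ch,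
      ‖deBruijnH t (rodgersTaoZ x κ) -
          ((π ^ 2 * (Real.sqrt (π / 8) * Real.exp (-(Real.log π / 2))) : ℝ) : ℂ) *
            cexp (-(9 + (κ * logPlus x : ℝ) + x * I) / 4 +
              (9 + (κ * logPlus x : ℝ) + x * I - 2) *
                (1 / 4 * Complex.log ((9 + (κ * logPlus x : ℝ) + x * I) / (4 * π))) +
              t * (1 / 4 * Complex.log ((9 + (κ * logPlus x : ℝ) + x * I) / (4 * π))) ^ 2)‖ ≤
        Kω * (logPlus x ^ 2 / x) *
          ‖cexp (-(9 + (κ * logPlus x : ℝ) + x * I) / 4 +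
              (9 + (κ * logPlus x : ℝ) + x * I - 2) *
                (1 / 4 * Complex.log ((9 + (κ * logPlus x : ℝ) + x * I) / (4 * π))) +
              t * (1 / 4 * Complex.log ((9 + (κ * logPlus x : ℝ) + x * I) / (4 * π))) ^ 2)‖ := by
  have hπ : 0 < π := Real.pi_pos
  -- constants
  set c₀ : ℝ := Real.sqrt (π / 8) * Real.exp (-(Real.log π / 2)) with hc₀
  have hc₀0 : 0 < c₀ := by positivity
  set K₁ : ℝ := 8 * AI / Real.sqrt π with hK₁
  have hK₁0 : 0 < K₁ := by positivity
  set K : ℝ := 12 * K₁ + 2 * c₀ * Ks with hK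
  have hK0 : 0 < K := by positivity
  set KQ : ℝ := 2 * π ^ 2 * K + 12 * π * K * Kg + 12 * π * c₀ * Kg with hKQ
  set Kω : ℝ := AQ * (2 * π ^ 2 * c₀ + KQ) + KQ / 2 with hKω
  have hKω0 : 0 < Kω := by positivity
  set ε : ℝ := min (1 / (Ks + 1)) (1 / (4 * (Ch + 1))) with hε
  have hε0 : 0 < ε := lt_min (by positivity) (by positivity)
  have hεKs : ε ≤ 1 / (Ks + 1) := min_le_left _ _
  have hεCh : ε ≤ 1 / (4 * (Ch + 1)) := min_le_right _ _
  set X : ℝ := max (max (max (max C''Q C''I) (max C''E Xs)) (4 * π + 18)) ((28 / ε) ^ 2) with hX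
  refine ⟨X, Kω, lt_of_lt_of_le (by positivity) ((le_max_right _ _).trans (le_max_left _ _)),
    hKω0, ?_⟩
  intro t ht x hx κ hκ
  -- thresholds
  have hxQ : C''Q ≤ x := le_trans (by simp [hX]) hx
  have hxI : C''I ≤ x := le_trans (by simp [hX]) hx
  have hxE : C''E ≤ x := le_trans (by simp [hX]) hx
  have hxs : Xs ≤ x := le_trans (by simp [hX]) hx
  have hx18 : 4 * π + 18 ≤ x := le_trans (by simp [hX]) hx
  have hxε : (28 / ε) ^ 2 ≤ x := le_trans (le_max_right _ _) hx
  have hx1 : 1 ≤ x := by linarith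
  have hx0 : 0 < x := by linarith
  have ht' : t ∈ Icc (-T) 0 := ⟨ht.1, ht.2.le⟩
  set E : ℝ := logPlus x ^ 2 / x with hEdef
  have hE0 : 0 ≤ E := by positivity
  have hEε : E ≤ ε := logPlus_sq_div_le_of_le hε0 hx1 hxε
  have hE1 : E ≤ 1 := hEε.trans (hεKs.trans (by rw [div_le_one (by positivity)]; linarith))
  have hKsE : Ks * E ≤ 1 := by
    calc Ks * E ≤ Ks * (1 / (Ks + 1)) := mul_le_mul_of_nonneg_left (hEε.trans hεKs) hKs.le
      _ ≤ 1 := by rw [← mul_div_assoc, mul_one, div_le_one (by positivity)]; linarith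
  have hxE4 : 1 / x ≤ 4 * E := one_div_le hx0
  have hL1 : 1 / 2 ≤ logPlus x := by
    have h := log_two_le_logPlus x
    have h2 : (1 / 2 : ℝ) ≤ Real.log 2 := by have := Real.log_two_gt_d9; linarith
    linarith
  have hL0 : 0 ≤ logPlus x := logPlus_nonneg x
  -- the point and `ζ₁`
  set y : ℝ := κ * logPlus x with hy
  have hy0 : 0 < y := mul_pos (hC'l.trans_le hκ.1) (logPlus_pos x)
  have hyCh : y ≤ Ch * logPlus x := mul_le_mul_of_nonneg_right hκ.2 hL0
  have hChL : Ch * logPlus x ≤ x / 2 := by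
    have h1 : logPlus x / x ≤ 2 * ε := (logPlus_div_le hx0).trans (by linarith only [hEε, hEdef])
    have h2 : logPlus x ≤ 2 * ε * x := by rwa [div_le_iff₀ hx0] at h1
    have h3 : Ch * logPlus x ≤ Ch * (2 * ε * x) := mul_le_mul_of_nonneg_left h2 hCh
    have h4 : Ch * (2 * ε) ≤ 1 / 2 := by
      calc Ch * (2 * ε) ≤ Ch * (2 * (1 / (4 * (Ch + 1)))) :=
            mul_le_mul_of_nonneg_left (by linarith only [hεCh]) hCh
        _ = Ch / (2 * (Ch + 1)) := by field_simp; ring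
        _ ≤ 1 / 2 := by rw [div_le_div_iff₀ (by positivity) (by norm_num)]; linarith only [hCh]
    have h5 : Ch * (2 * ε * x) = Ch * (2 * ε) * x := by ring
    rw [h5] at h3
    have h6 : Ch * (2 * ε) * x ≤ 1 / 2 * x := mul_le_mul_of_nonneg_right h4 hx0.le
    linarith only [h3, h6]
  set ζ₁ : ℂ := 9 + (y : ℂ) + x * I with hζ₁
  have hζ1re : ζ₁.re = 9 + y := by simp [hζ₁]
  have hζ1im : ζ₁.im = x := by simp [hζ₁]
  have hζ2re : (ζ₁ - 4).re = 5 + y := by simp [hζ₁]; ring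
  have hζ2im : (ζ₁ - 4).im = x := by simp [hζ₁]
  have hζ1n : ‖ζ₁‖ ≤ 2 * x := by
    calc ‖ζ₁‖ ≤ |ζ₁.re| + |ζ₁.im| := norm_le_abs_re_add_abs_im _
      _ = 9 + y + x := by rw [hζ1re, hζ1im, abs_of_pos (by linarith only [hy0]), abs_of_pos hx0]
      _ ≤ 2 * x := by linarith only [hyCh, hChL, hx18, hπ]
  have hζ1n3 : ‖ζ₁‖ ≤ 3 * ζ₁.im := by rw [hζ1im]; linarith
  have hζ2n3 : ‖ζ₁ - 4‖ ≤ 3 * (ζ₁ - 4).im := by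
    rw [hζ2im]
    calc ‖ζ₁ - 4‖ ≤ ‖ζ₁‖ + ‖(4 : ℂ)‖ := norm_sub_le _ _
      _ ≤ 3 * x := by norm_num; linarith
  -- `Ω` memberships
  have hΩ : ∀ C'' : ℝ, C'' ≤ x → ζ₁ ∈ rodgersTaoOmega (Ch + 10) C'l C'' ∧
      ζ₁ - 4 ∈ rodgersTaoOmega (Ch + 10) C'l C'' := by
    intro C'' hC''
    have h0 : 0 ≤ Ch * logPlus x := mul_nonneg hCh hL0
    have h1 : C'l * logPlus x ≤ y := mul_le_mul_of_nonneg_right hκ.1 hL0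
    have h2 : 9 + y ≤ 2 * (Ch + 10) * logPlus x := by linarith only [hyCh, hL1, h0]
    simp only [rodgersTaoOmega, Set.mem_setOf_eq, hζ1im, hζ1re, hζ2im, hζ2re]
    exact ⟨⟨hC'', by linarith only [h1, hy0], h2⟩, ⟨hC'', by linarith only [h1], by
      linarith only [h2]⟩⟩
  -- `Q_{t,1}` in terms of `I_t(π, ζ₁)` and `I_t(π, ζ₁ − 4)`
  have hQ1 : rodgersTaoQ t 1 x y = 2 * π ^ 2 * rodgersTaoI t π ζ₁ - 3 * π * rodgersTaoI t π (ζ₁ - 4) := by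
    have e : (5 : ℂ) + (y : ℂ) + x * I = ζ₁ - 4 := by simp only [hζ₁]; ring
    simp only [rodgersTaoQ, Nat.cast_one, one_pow, mul_one, e]
    rw [hζ₁]
  -- saddle points
  obtain ⟨w₁s, hw₁s, hS₁⟩ := hE'' t ht' ζ₁ (hΩ C''E hxE).1
  obtain ⟨w₂s, hw₂s, hS₂⟩ := hE'' t ht' (ζ₁ - 4) (hΩ C''E hxE).2
  -- (31) and the saddle-point bounds
  have h31₁ := hI'' t ht ζ₁ (hΩ C''I hxI).1 w₁s hw₁s hS₁
  have h31₂ := hI'' t ht (ζ₁ - 4) (hΩ C''I hxI).2 w₂s hw₂s hS₂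
  obtain ⟨hlow₁, -, -, hph₁⟩ := hsad t ht' ζ₁ w₁s (by rw [hζ1re]; linarith) hζ1n3
    (by rw [hζ1im]; exact hxs) hw₁s hS₁
  obtain ⟨hlow₂, -, -, hph₂⟩ := hsad t ht' (ζ₁ - 4) w₂s (by rw [hζ2re]; linarith) hζ2n3
    (by rw [hζ2im]; exact hxs) hw₂s hS₂
  rw [hζ1im] at hlow₁ hph₁
  rw [hζ2im] at hlow₂ hph₂
  -- exponential forms
  have hexp₁ := exp_form_of_I_asymp hAI.le hx0 hw₁s hlow₁ h31₁
  have hexp₂ := exp_form_of_I_asymp hAI.le hx0 hw₂s hlow₂ h31₂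
  have hph₁' : ‖(t * w₁s ^ 2 - π * cexp (4 * w₁s) + ζ₁ * w₁s - 2 * w₁s) -
      (-ζ₁ / 4 + (ζ₁ - 2) * (1 / 4 * Complex.log (ζ₁ / (4 * π))) +
        t * (1 / 4 * Complex.log (ζ₁ / (4 * π))) ^ 2)‖ ≤ Ks * E := by
    rw [hEdef, ← mul_div_assoc]; exact hph₁
  have hph₂' : ‖(t * w₂s ^ 2 - π * cexp (4 * w₂s) + (ζ₁ - 4) * w₂s - 2 * w₂s) -
      (-(ζ₁ - 4) / 4 + (ζ₁ - 4 - 2) * (1 / 4 * Complex.log ((ζ₁ - 4) / (4 * π))) +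
        t * (1 / 4 * Complex.log ((ζ₁ - 4) / (4 * π))) ^ 2)‖ ≤ Ks * E := by
    rw [hEdef, ← mul_div_assoc]; exact hph₂
  have htr₁ := exp_form_transfer hc₀0.le hK₁0.le hx0 hxE4 hexp₁ hph₁' hKsE
  have htr₂ := exp_form_transfer hc₀0.le hK₁0.le hx0 hxE4 hexp₂ hph₂' hKsE
  -- the second phase is smaller
  have hg := hgsub t ht' ζ₁ (by rw [hζ1re]; linarith) (by rw [hζ1im]; exact hζ1n)
    (by rw [hζ1im]; linarith)
  rw [hζ1im] at hg
  set g₁ : ℂ := -ζ₁ / 4 + (ζ₁ - 2) * (1 / 4 * Complex.log (ζ₁ / (4 * π))) +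
    t * (1 / 4 * Complex.log (ζ₁ / (4 * π))) ^ 2 with hg₁
  set g₂ : ℂ := -(ζ₁ - 4) / 4 + (ζ₁ - 4 - 2) * (1 / 4 * Complex.log ((ζ₁ - 4) / (4 * π))) +
    t * (1 / 4 * Complex.log ((ζ₁ - 4) / (4 * π))) ^ 2 with hg₂
  have hg' : ‖cexp g₂‖ ≤ Kg / x * ‖cexp g₁‖ := by
    have e : cexp g₂ = cexp (g₂ - g₁) * cexp g₁ := by rw [← Complex.exp_add]; ring_nf
    rw [e, norm_mul]
    exact mul_le_mul_of_nonneg_right hg (norm_nonneg _)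
  -- the p.19 estimate at the point
  have hH := hQ'' t ht x hxQ κ hκ
  rw [← hy] at hH
  -- bookkeeping
  have hmain := main_term_bookkeeping (H := deBruijnH t (rodgersTaoZ x κ)) hc₀0.le hK0.le hKg.le
    hAQ.le hE0 hxE4 hE1 hQ1 htr₁ htr₂ hg' hH
  -- repackage
  have e2 : AQ * (2 * π ^ 2 * c₀ + (2 * π ^ 2 * K + 12 * π * K * Kg + 12 * π * c₀ * Kg)) +
      (2 * π ^ 2 * K + 12 * π * K * Kg + 12 * π * c₀ * Kg) / 2 = Kω := by
    simp only [hKω, hKQ]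
  rw [e2] at hmain
  exact hmain

/-! ## §10 Borel–Carathéodory and the assembly of (9) -/

/-- **Logarithmic derivative from a multiplicative approximation** (the "Borel–Carathéodory theorem
and the Cauchy integral formula" step of FMP p. 19): if `H` and `G` are holomorphic on the disc
`|w − z| < R`, and `‖H(w) − m e^{G(w)}‖ ≤ η ‖e^{G(w)}‖` there with `0 < η ≤ m/2`, then
`‖H'(z)/H(z) − G'(z)‖ ≤ 6η/(mR)`. [cite: RodgersTaoFMP2020, §2 p. 19 (FMP); folklore form] -/
theorem logDeriv_near_of_near_exp {H G : ℂ → ℂ} {G'z z : ℂ} {m η R : ℝ} (hm : 0 < m) (hη : 0 < η)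
    (hηm : η ≤ m / 2) (hR : 0 < R) (hH : DifferentiableOn ℂ H (Metric.ball z R))
    (hG : DifferentiableOn ℂ G (Metric.ball z R)) (hGz : HasDerivAt G G'z z)
    (hnear : ∀ w ∈ Metric.ball z R, ‖H w - m * cexp (G w)‖ ≤ η * ‖cexp (G w)‖) :
    ‖deriv H z / H z - G'z‖ ≤ 6 * η / (m * R) := by
  set F : ℂ → ℂ := fun w ↦ H w * cexp (-G w) with hF
  have hz : z ∈ Metric.ball z R := Metric.mem_ball_self hR
  have hFd : DifferentiableOn ℂ F (Metric.ball z R) := hH.mul (hG.neg.cexp)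
  -- `‖F w − m‖ ≤ η`
  have hFm : ∀ w ∈ Metric.ball z R, ‖F w - m‖ ≤ η := by
    intro w hw
    have h1' : cexp (-G w) * cexp (G w) = 1 := by
      rw [← Complex.exp_add]; simp
    have e : F w - m = cexp (-G w) * (H w - m * cexp (G w)) := by
      show H w * cexp (-G w) - m = _
      have : cexp (-G w) * (H w - m * cexp (G w)) =
          H w * cexp (-G w) - m * (cexp (-G w) * cexp (G w)) := by ring
      rw [this, h1', mul_one]
    rw [e, norm_mul]
    have h1 : ‖cexp (-G w)‖ * ‖cexp (G w)‖ = 1 := by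
      rw [← norm_mul, h1']; simp
    calc ‖cexp (-G w)‖ * ‖H w - m * cexp (G w)‖ ≤ ‖cexp (-G w)‖ * (η * ‖cexp (G w)‖) :=
          mul_le_mul_of_nonneg_left (hnear w hw) (norm_nonneg _)
      _ = η := by rw [mul_left_comm, h1, mul_one]
  have hFlow : ∀ w ∈ Metric.ball z R, m - η ≤ ‖F w‖ := by
    intro w hw
    have := norm_sub_norm_le (m : ℂ) (F w)
    rw [norm_sub_rev, Complex.norm_real, Real.norm_of_nonneg hm.le] at this
    linarith [hFm w hw]
  have hFup : ∀ w ∈ Metric.ball z R, ‖F w‖ ≤ m + η := by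
    intro w hw
    have := norm_le_norm_add_norm_sub' (F w) (m : ℂ)
    rw [Complex.norm_real, Real.norm_of_nonneg hm.le] at this
    linarith [hFm w hw]
  have hF0 : ∀ w ∈ Metric.ball z R, F w ≠ 0 := by
    intro w hw h
    have := hFlow w hw
    rw [h, norm_zero] at this
    linarith
  -- `log ‖F w‖ ≤ log ‖F z‖ + 3η/m`
  set M : ℝ := 3 * η / m with hM
  have hM0 : 0 < M := by positivity
  have hlog : ∀ w ∈ Metric.ball z R, Real.log ‖F w‖ ≤ Real.log ‖F z‖ + M := by
    intro w hw
    have hpos : 0 < m - η := by linarith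
    have h1 : Real.log ‖F w‖ ≤ Real.log (m + η) :=
      Real.log_le_log (hpos.trans_le (hFlow w hw)) (hFup w hw)
    have h2 : Real.log (m - η) ≤ Real.log ‖F z‖ := Real.log_le_log hpos (hFlow z hz)
    have h3 : Real.log (m + η) ≤ Real.log m + η / m := by
      have : Real.log (m + η) - Real.log m = Real.log ((m + η) / m) := by
        rw [Real.log_div (by positivity) hm.ne']
      have h4 : Real.log ((m + η) / m) ≤ (m + η) / m - 1 :=
        Real.log_le_sub_one_of_pos (by positivity)
      have h5 : (m + η) / m - 1 = η / m := by field_simp; ring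
      linarith
    have h4 : Real.log m - 2 * η / m ≤ Real.log (m - η) := by
      have e : Real.log (m - η) - Real.log m = Real.log ((m - η) / m) := by
        rw [Real.log_div hpos.ne' hm.ne']
      have h5 : 1 - ((m - η) / m)⁻¹ ≤ Real.log ((m - η) / m) :=
        Real.one_sub_inv_le_log_of_pos (by positivity)
      have h6 : -(2 * η / m) ≤ 1 - ((m - η) / m)⁻¹ := by
        rw [inv_div]
        have h7 : m / (m - η) ≤ 1 + 2 * η / m := by
          rw [div_le_iff₀ hpos]
          have h8 : (1 + 2 * η / m) * (m - η) = m + η - 2 * η ^ 2 / m := by field_simp; ring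
          rw [h8]
          have h9 : 2 * η ^ 2 / m ≤ η := by
            rw [div_le_iff₀ hm]; nlinarith
          linarith
        linarith
      linarith
    have e3 : M = η / m + 2 * η / m := by simp only [hM]; ring
    linarith
  -- Borel–Carathéodory
  have hBC := Literature.Analysis.Complex.norm_logDeriv_le_of_log_norm_le hM0 hR hFd hF0 hlog
  -- `F'/F = H'/H − G'`
  have hHz : DifferentiableAt ℂ H z := hH.differentiableAt (Metric.isOpen_ball.mem_nhds hz)
  have hHd : HasDerivAt H (deriv H z) z := hHz.hasDerivAt
  have hFder : HasDerivAt F (deriv H z * cexp (-G z) + H z * (cexp (-G z) * -G'z)) z :=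
    hHd.mul hGz.neg.cexp
  have hH0 : H z ≠ 0 := by
    intro h; apply hF0 z hz; simp [hF, h]
  have e : deriv F z / F z = deriv H z / H z - G'z := by
    rw [hFder.deriv]
    simp only [hF]
    field_simp [Complex.exp_ne_zero]
    ring
  rw [← e]
  calc ‖deriv F z / F z‖ ≤ 2 * M / R := hBC
    _ = 6 * η / (m * R) := by simp only [hM]; field_simp; ring

/-- The phase at a disc point: `9 + κ' log₊ x' + i x' = 9 + i w` for `w = x' − iκ' log₊ x'`. [folklore] -/
private theorem nine_add_eq (w : ℂ) :
    (9 : ℂ) + ((-w.im / logPlus w.re * logPlus w.re : ℝ) : ℂ) + (w.re : ℂ) * I = 9 + I * w := by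
  have hL : logPlus w.re ≠ 0 := (logPlus_pos _).ne'
  have e : -w.im / logPlus w.re * logPlus w.re = -w.im := by field_simp
  rw [e]
  apply Complex.ext <;> simp

end RodgersTaoLogDeriv

open RodgersTaoLogDeriv in
/-- **Rodgers–Tao (9) from the `n = 1` main-term inputs.** The logarithmic-derivative asymptotic
`H_t'/H_t(x − iκ log₊ x) = (i/4) Log(iz/4π) + O(log₊ x / x)` (FMP Lemma 4, eq. (9)) for
`−T₀ ≤ t ≤ 0`, derived from the p. 19 estimate `H_t = ½Q_{t,1}(1 + O(log₊² x/x))`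
(`rodgersTao_H_eq_half_Q_one`) and the stationary-phase asymptotic (31) (`rodgersTao_I_asymp`),
via Lemma 2.3 (existence of strip saddle points, `rodgersTao_saddleEq_exists`), the explicit
holomorphic main term `π² c₀ e^{g_t(9 + iw)}` on discs of radius `log₊ x / 2`, and the
Borel–Carathéodory step of p. 19; the endpoint `t = 0` is `rodgersTao_logDeriv_H0_asymp_holds`.
[cite: RodgersTaoFMP2020, Lemma 2.1 (iii) eq. (9) and §2 p. 19 (FMP Lemma 4 p. 9, p. 19)] -/
theorem rodgersTao_logDeriv_H_asymp_of (hQ : rodgersTao_H_eq_half_Q_one)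
    (hI : rodgersTao_I_asymp) : rodgersTao_logDeriv_H_asymp := by
  intro T₀
  have hπ : 0 < π := Real.pi_pos
  set T : ℝ := max T₀ 0 with hTdef
  have hT : 0 ≤ T := le_max_right _ _
  obtain ⟨C'Q, hC'Q, hQ'⟩ := hQ T
  obtain ⟨C'I, hC'I, hI'⟩ := hI T
  obtain ⟨C'E, hC'E, hE'⟩ := rodgersTao_saddleEq_exists T
  obtain ⟨C'₀, hC'₀, h0⟩ := rodgersTao_logDeriv_H0_asymp_holds
  obtain ⟨Xs, Ks, hXs, hKs, hsad⟩ := saddle_perturbation T hT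
  obtain ⟨Kg, hKg, hgsub⟩ := norm_cexp_phase_sub_le T hT
  set C'l : ℝ := max (max C'Q C'I) C'E with hC'l
  have hC'lQ : C'Q ≤ C'l := (le_max_left _ _).trans (le_max_left _ _)
  have hC'lI : C'I ≤ C'l := (le_max_right _ _).trans (le_max_left _ _)
  have hC'lE : C'E ≤ C'l := le_max_right _ _
  have hC'l0 : 0 < C'l := hC'Q.trans_le hC'lQ
  refine ⟨max (2 * C'l + 2) C'₀, lt_max_of_lt_left (by positivity), fun C ↦ ?_⟩
  set Ch : ℝ := 2 * max C 0 + 1 with hCh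
  have hCh0 : 0 ≤ Ch := by simp only [hCh]; positivity
  obtain ⟨C''Q, AQ, hC''Q, hAQ, hQ''⟩ := hQ' Ch
  obtain ⟨C''I, AI, hC''I, hAI, hI''⟩ := hI' C'l hC'lI (Ch + 10)
  obtain ⟨C''E, hC''E, hE''⟩ := hE' C'l hC'lE (Ch + 10)
  obtain ⟨A0, hA0, h0'⟩ := h0 C
  have hπ1 : (1 : ℝ) ≤ π := by linarith [Real.pi_gt_three]
  -- the pointwise package
  obtain ⟨Xp, Kω, hXp, hKω, hpt⟩ := pointwise_estimate (T := T) hC'l0 hCh0 hAQ hAI hKs hKg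
    (fun t ht x hx κ hκ ↦ hQ'' t ht x hx κ ⟨hC'lQ.trans hκ.1, hκ.2⟩)
    (fun t ht ζ hζ w₀ hw₀ hS ↦ hI'' C''I le_rfl t ht π hπ1 ζ hζ w₀ hw₀ hS)
    (fun t ht ζ hζ ↦ hE'' C''E le_rfl t ht π hπ1 ζ hζ) hsad hgsub
  -- constants
  set c₀ : ℝ := Real.sqrt (π / 8) * Real.exp (-(Real.log π / 2)) with hc₀
  have hc₀0 : 0 < c₀ := by positivity
  set m : ℝ := π ^ 2 * c₀ with hmdef
  have hm0 : 0 < m := by positivity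
  set ε₃ : ℝ := min (m / (16 * Kω)) (1 / (4 * (Ch + 1))) with hε₃
  have hε₃0 : 0 < ε₃ := lt_min (by positivity) (by positivity)
  have hε₃m : ε₃ ≤ m / (16 * Kω) := min_le_left _ _
  have hε₃C : ε₃ ≤ 1 / (4 * (Ch + 1)) := min_le_right _ _
  set KG : ℝ := 8 + T * (1 + 2 * Real.log 3 + 2 * π) / 8 with hKG
  have hlog3 : 0 ≤ Real.log 3 := Real.log_nonneg (by norm_num)
  have hKG0 : 0 < KG := by positivity
  set A : ℝ := 96 * Kω / m + KG + A0 with hA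
  have hApos : 0 < A := by positivity
  set X : ℝ := max (max (2 * Xp) (4 * π + 2)) ((28 / ε₃) ^ 2) with hX
  refine ⟨X, A, lt_max_of_lt_left (lt_max_of_lt_left (by positivity)), hApos, ?_⟩
  intro t ht x hx κ hκ
  have hxXp : 2 * Xp ≤ x := le_trans ((le_max_left _ _).trans (le_max_left _ _)) hx
  have hx4π : 4 * π + 2 ≤ x := le_trans ((le_max_right _ _).trans (le_max_left _ _)) hx
  have hxε : (28 / ε₃) ^ 2 ≤ x := le_trans (le_max_right _ _) hx
  have hx2 : 2 ≤ x := by linarith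
  have hx1 : 1 ≤ x := by linarith
  have hx0 : 0 < x := by linarith
  have hκC' : 2 * C'l + 2 ≤ κ := le_trans (le_max_left _ _) hκ.1
  have hκ0' : C'₀ ≤ κ := le_trans (le_max_right _ _) hκ.1
  have hκpos : 0 < κ := by linarith
  have hL0 : 0 < logPlus x := logPlus_pos x
  have hL1 : 1 / 2 ≤ logPlus x := by
    have h := log_two_le_logPlus x
    have h2 : (1 / 2 : ℝ) ≤ Real.log 2 := by have := Real.log_two_gt_d9; linarith
    linarith
  set z : ℂ := rodgersTaoZ x κ with hzdef
  rcases eq_or_lt_of_le ht.2 with h0t | htlt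
  · -- the endpoint `t = 0`
    rw [h0t]
    have h := h0' x hx0 κ ⟨hκ0', hκ.2⟩
    refine h.trans ?_
    rw [mul_div_assoc, mul_div_assoc]
    refine mul_le_mul_of_nonneg_right ?_ (by positivity)
    simp only [hA]; linarith [show 0 ≤ 96 * Kω / m from by positivity]
  -- `t < 0`
  have htT : t ∈ Ico (-T) 0 := ⟨by linarith [ht.1, le_max_left T₀ 0], htlt⟩
  have habs : |t| ≤ T := by rw [abs_of_neg htlt]; linarith [ht.1, le_max_left T₀ 0]
  set R : ℝ := logPlus x / 2 with hRdef
  have hR0 : 0 < R := by positivity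
  set E : ℝ := logPlus x ^ 2 / x with hEdef
  have hE0 : 0 < E := by positivity
  have hEε : E ≤ ε₃ := logPlus_sq_div_le_of_le hε₃0 hx1 hxε
  set η : ℝ := 8 * Kω * E with hηdef
  have hη0 : 0 < η := by positivity
  have hηm : η ≤ m / 2 := by
    calc η = 8 * Kω * E := rfl
      _ ≤ 8 * Kω * (m / (16 * Kω)) := mul_le_mul_of_nonneg_left (hEε.trans hε₃m) (by positivity)
      _ = m / 2 := by field_simp; ring
  -- the explicit phase along `9 + i w`
  set G : ℂ → ℂ := fun w ↦ -(9 + I * w) / 4 +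
      (9 + I * w - 2) * (1 / 4 * Complex.log ((9 + I * w) / (4 * π))) +
      t * (1 / 4 * Complex.log ((9 + I * w) / (4 * π))) ^ 2 with hGdef
  have hre_of_mem : ∀ w ∈ Metric.ball z R, 0 < (9 + I * w).re := by
    intro w hw
    obtain ⟨-, hκ'1, -, -, -⟩ := disc_point hx2 (by linarith) hw
    have h1 : 0 ≤ -w.im / logPlus w.re := le_trans (by linarith) hκ'1
    have h2 : 0 ≤ -w.im := by
      have := mul_nonneg h1 (logPlus_nonneg w.re)
      rwa [div_mul_cancel₀ _ (logPlus_pos w.re).ne'] at this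
    have : (9 + I * w).re = 9 - w.im := by simp [sub_eq_add_neg]
    rw [this]; linarith
  have hzmem : z ∈ Metric.ball z R := Metric.mem_ball_self hR0
  have hGd : DifferentiableOn ℂ G (Metric.ball z R) := fun w hw ↦
    (hasDerivAt_phase t (hre_of_mem w hw)).differentiableAt.differentiableWithinAt
  have hGz := hasDerivAt_phase t (hre_of_mem z hzmem)
  have hHd : DifferentiableOn ℂ (deBruijnH t) (Metric.ball z R) :=
    (differentiable_deBruijnH_holds t).differentiableOn
  -- the pointwise estimate on the disc
  have hnear : ∀ w ∈ Metric.ball z R, ‖deBruijnH t w - m * cexp (G w)‖ ≤ η * ‖cexp (G w)‖ := by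
    intro w hw
    obtain ⟨hx', hκ'1, hκ'2, hwz, hE'⟩ := disc_point hx2 (by linarith) hw
    set x' : ℝ := w.re with hx'def
    set κ' : ℝ := -w.im / logPlus w.re with hκ'def
    have hx'X : Xp ≤ x' := by linarith
    have hκ'mem : κ' ∈ Icc C'l Ch := by
      constructor
      · linarith
      · have : κ ≤ max C 0 := hκ.2.trans (le_max_left _ _)
        simp only [hCh]; linarith
    have h := hpt t htT x' hx'X κ' hκ'mem
    rw [hwz, nine_add_eq w] at h
    have hm' : ((π ^ 2 * (Real.sqrt (π / 8) * Real.exp (-(Real.log π / 2))) : ℝ) : ℂ) = (m : ℂ) := by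
      simp only [hmdef, hc₀]
    rw [hm'] at h
    refine h.trans ?_
    have hE8 : Kω * (logPlus x' ^ 2 / x') ≤ η := by
      calc Kω * (logPlus x' ^ 2 / x') ≤ Kω * (8 * (logPlus x ^ 2 / x)) :=
            mul_le_mul_of_nonneg_left hE' hKω.le
        _ = η := by simp only [hηdef, hEdef]; ring
    exact mul_le_mul_of_nonneg_right hE8 (norm_nonneg _)
  -- Borel–Carathéodory
  have hBC := logDeriv_near_of_near_exp hm0 hη0 hηm hR0 hHd hGd hGz hnear
  -- the derivative of the phase versus `(i/4) Log(iz/4π)`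
  have hζ3 : ‖9 + I * z‖ ≤ 3 * x := by
    have h1 : ‖9 + I * z‖ ≤ |(9 + I * z).re| + |(9 + I * z).im| := norm_le_abs_re_add_abs_im _
    have hre : (9 + I * z).re = 9 + κ * logPlus x := by simp [hzdef, rodgersTaoZ]
    have him : (9 + I * z).im = x := by simp [hzdef, rodgersTaoZ]
    have hy0 : 0 < κ * logPlus x := mul_pos hκpos hL0
    rw [hre, him, abs_of_pos (by linarith), abs_of_pos hx0] at h1
    have hκCh : κ * logPlus x ≤ Ch * logPlus x := by
      have : κ ≤ Ch := by
        have : κ ≤ max C 0 := hκ.2.trans (le_max_left _ _)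
        simp only [hCh]; linarith
      exact mul_le_mul_of_nonneg_right this hL0.le
    have hChL : Ch * logPlus x ≤ x / 2 := by
      have h2 : logPlus x / x ≤ 2 * ε₃ := (logPlus_div_le hx0).trans (by linarith only [hEε, hEdef])
      have h3 : logPlus x ≤ 2 * ε₃ * x := by rwa [div_le_iff₀ hx0] at h2
      have h4 : Ch * logPlus x ≤ Ch * (2 * ε₃) * x := by
        have := mul_le_mul_of_nonneg_left h3 hCh0; linarith only [this]
      have h5 : Ch * (2 * ε₃) ≤ 1 / 2 := by
        calc Ch * (2 * ε₃) ≤ Ch * (2 * (1 / (4 * (Ch + 1)))) :=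
              mul_le_mul_of_nonneg_left (by linarith only [hε₃C]) hCh0
          _ = Ch / (2 * (Ch + 1)) := by field_simp; ring
          _ ≤ 1 / 2 := by
              rw [div_le_div_iff₀ (by positivity) (by norm_num)]; linarith only [hCh0]
      have h6 : Ch * (2 * ε₃) * x ≤ 1 / 2 * x := mul_le_mul_of_nonneg_right h5 hx0.le
      linarith only [h4, h6]
    linarith only [h1, hκCh, hChL, hx4π, Real.pi_gt_three]
  have hG' := phase_deriv_near (T₀ := T) habs (by linarith) (mul_pos hκpos hL0) hζ3
  -- assembly
  have htri := norm_sub_le_norm_sub_add_norm_sub (deriv (deBruijnH t) z / deBruijnH t z)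
    (I / 4 * Complex.log ((9 + I * z) / (4 * π)) - I / (2 * (9 + I * z)) +
      I * t / 8 * Complex.log ((9 + I * z) / (4 * π)) / (9 + I * z))
    (I / 4 * Complex.log (I * z / (4 * π)))
  have e1 : 6 * η / (m * R) = 96 * Kω / m * (logPlus x / x) := by
    simp only [hηdef, hRdef, hEdef]; field_simp; ring
  have e2 : (4 + T * (logPlus x + Real.log 3 + π) / 8) / x ≤ KG * (logPlus x / x) := by
    rw [show KG * (logPlus x / x) = (KG * logPlus x) / x by ring]
    refine div_le_div_of_nonneg_right ?_ hx0.le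
    have h1 : (4 : ℝ) ≤ 8 * logPlus x := by linarith
    have h2 : Real.log 3 + π ≤ (2 * Real.log 3 + 2 * π) * logPlus x := by
      have e : Real.log 3 + π = (2 * Real.log 3 + 2 * π) * (1 / 2) := by ring
      rw [e]; exact mul_le_mul_of_nonneg_left hL1 (by positivity)
    have h3 : T * (logPlus x + Real.log 3 + π) ≤ T * ((1 + 2 * Real.log 3 + 2 * π) * logPlus x) :=
      mul_le_mul_of_nonneg_left (by linarith) hT
    calc 4 + T * (logPlus x + Real.log 3 + π) / 8
        ≤ 8 * logPlus x + T * ((1 + 2 * Real.log 3 + 2 * π) * logPlus x) / 8 := by linarith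
      _ = KG * logPlus x := by simp only [hKG]; ring
  have e3 : 96 * Kω / m * (logPlus x / x) + KG * (logPlus x / x) ≤ A * logPlus x / x := by
    have : A * logPlus x / x = (96 * Kω / m + KG + A0) * (logPlus x / x) := by
      simp only [hA]; ring
    rw [this]
    have : 0 ≤ A0 * (logPlus x / x) := by positivity
    linarith
  calc ‖deriv (deBruijnH t) z / deBruijnH t z - I / 4 * Complex.log (I * z / (4 * π))‖
      ≤ ‖deriv (deBruijnH t) z / deBruijnH t z -
          (I / 4 * Complex.log ((9 + I * z) / (4 * π)) - I / (2 * (9 + I * z)) +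
            I * t / 8 * Complex.log ((9 + I * z) / (4 * π)) / (9 + I * z))‖ +
        ‖(I / 4 * Complex.log ((9 + I * z) / (4 * π)) - I / (2 * (9 + I * z)) +
            I * t / 8 * Complex.log ((9 + I * z) / (4 * π)) / (9 + I * z)) -
          I / 4 * Complex.log (I * z / (4 * π))‖ := htri
    _ ≤ 6 * η / (m * R) + (4 + T * (logPlus x + Real.log 3 + π) / 8) / x := add_le_add hBC hG'
    _ ≤ 96 * Kω / m * (logPlus x / x) + KG * (logPlus x / x) := by rw [e1]; linarith
    _ ≤ A * logPlus x / x := e3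

open RodgersTaoLogDeriv in
/-- **Rodgers–Tao (9) from the p. 19 estimate alone**, the stationary-phase input (31) being the
kernel theorem `rodgersTao_I_asymp_holds`. [cite: RodgersTaoFMP2020, Lemma 2.1 (iii) eq. (9) (FMP Lemma 4 p. 9, p. 19)] -/
theorem rodgersTao_logDeriv_H_asymp_of_H_eq_half_Q_one (hQ : rodgersTao_H_eq_half_Q_one) :
    rodgersTao_logDeriv_H_asymp :=
  rodgersTao_logDeriv_H_asymp_of hQ rodgersTao_I_asymp_holds

end Literature.NumberTheory.LFunctions

end
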